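import Literature.NumberTheory.Sieve.BombieriAsymptoticSieveVector
import Literature.NumberTheory.Sieve.BombieriAsymptoticSieveTheorem1
import HarnessLib

/-!
# Bombieri's asymptotic sieve: Theorem 1 for vectors `(k)` — PROVED

Topic `Literature/NumberTheory/Sieve`, companion ("Proofs") file of `BombieriAsymptoticSieveVector.lean`:
it discharges the named fact `Bombieri1976_asymptotic_sieve_vector`
(`Bombieri1976_asymptotic_sieve_vector_holds`, at the end of the file).
Source: J. Friedlander, H. Iwaniec, *On Bombieri's asymptotic sieve*, Ann. Scuola Norm. Sup. Pisa
Cl. Sci. (4) **5** (1978) 719–756 [FriedlanderIwaniecPisa1978], §2 Lemmata 1, 3 (pp. 725–728) and §4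
(pp. 735–740), read from the rendered Numdam scan. The tree proves Theorem 1 for SCALAR `(k)`
(`Bombieri1976_asymptotic_sieve_holds`) along §4 with `𝔏_(k') = μ`; this file runs the same
proof for a general vector `(k) = ((k'), a)`, `a ≥ 2` (p. 735: "Let `(k) = ((k'), a)` … The order
of the components is clearly immaterial"), the Möbius function being replaced by the signed
weight `𝔏_(k') = μ * Λ_(k')` (p. 725, Definition), bounded by Lemma 1 (iii):
`|𝔏_(k')(n)| ≤ (log n)^{|k'|}`. Contents, in the order of the printed proof:

* Lemma 1 (ii), (iii) for `K = ℚ`: `Λ_(k) ≤ Λ_{|k|}` (`lambdaVec_le_sum`, by the monotone derivation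
  `h ↦ h·log + Λ * h`, which maps `Λ_k` to `Λ_{k+1}`), `|𝔏_(k)(n)| ≤ (log n)^{|k|}` (`abs_frakL_le`);
* the dissection `∑_{n ≤ x} a_n Λ_(k)(n) = Σ₀ + Σ₁ + Σ₂` of p. 735 with
  `Λ_(k)(n) = ∑_{d ∣ n} 𝔏_(k')(d)(log n/d)^a` (`sigma0V`, `sigma1V`, `sigma2V`,
  `sum_eq_sigma0V_add_sigma1V_add_sigma2V`);
* Lemma 10 for vectors from the tree's scalar Lemma 10 (`sigma0V_le_sigma0`: `Λ_(k) ≤ Λ_{|k|}`);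
* Lemma 11 for vectors (`lemma11V`): `|Σ₂| ≤ (log x/y)^a (log x)^{|k'|} ∑_{m ≤ x/y} S(𝒜_m, z; x)`
  and the tree's fundamental-lemma bound for the latter;
* Lemma 12 for vectors (`lemma12V`): the tree's Lemma 12 machinery (`FI1978_lemma12_core`) run with the
  weight `𝔏_(k')(d)(log x/d)^a`, `|𝔏_(k')| ≤ (log x)^{|k'|}`;
* the core estimate `coreV` (`Σ₀ + Σ₁ + Σ₂` against `H A(x) F(x; y, z)` with the common main term
  `mainTermFV`), exactly as the tree's `BombieriSieve.core`;
* Lemma 3 for vectors over `ℚ` (`lemma3V`): `∑_{n ≤ x} Λ_(k)(n) ∼ γ(k) x (log x)^{|k|−1}`,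
  `γ(k) = ∏ kᵢ!/(|k|−1)!`, by induction on the number of components from the tree's scalar Lemma 3,
  the step being Dirichlet's rearrangement with a weighted Mertens estimate for `Λ_b`
  (`weightedMertens_generalizedVonMangoldt`: `∑_{d ≤ x} Λ_b(d)/d (log x/d)^m =
  (b! m!/(b+m)!) (log x)^{b+m} + O((1 + log x)^{b+m−1})`, itself by induction on `b` via
  `Λ_{b+1} = Λ_b·log + Λ * Λ_b`);
* the comparison with the integers (p. 740) at a common `u` (`vector_cons`) and the reduction of a
  general admissible `k` to one with its entry `≥ 2` in front (`Bombieri1976_asymptotic_sieve_vector_holds`).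
-/

noncomputable section

open Finset Filter Asymptotics MeasureTheory Topology
open scoped ArithmeticFunction.Moebius ArithmeticFunction.vonMangoldt ArithmeticFunction.zeta

namespace Literature.NumberTheory.Sieve

namespace BombieriSieve

/-! ### [FriedlanderIwaniecPisa1978] Lemma 1 (ii), (iii) for `K = ℚ` -/

/-- `Λ_(k) = ∏ Λ_{k_i}` (Dirichlet product) — a local name for `(ks.map Λ).prod`. [cite: FriedlanderIwaniecPisa1978, p. 721 (definition of Λ_(k))] -/
abbrev lambdaVec (ks : List ℕ) : ArithmeticFunction ℝ := (ks.map generalizedVonMangoldt).prod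

/-- Monotonicity of the Dirichlet product in one factor, for a nonnegative other factor. [folklore] -/
theorem mul_apply_le_mul_apply {f g₁ g₂ : ArithmeticFunction ℝ} (hf : ∀ n, 0 ≤ f n)
    (hg : ∀ n, g₁ n ≤ g₂ n) (n : ℕ) : (f * g₁) n ≤ (f * g₂) n := by
  rw [ArithmeticFunction.mul_apply, ArithmeticFunction.mul_apply]
  exact Finset.sum_le_sum fun x _ => mul_le_mul_of_nonneg_left (hg _) (hf _)

/-- The Leibniz-defect inequality: for `f, g ≥ 0`, `((f·log) * g)(n) ≤ ((f * g)·log)(n)`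
(`log d ≤ log n` for `d ∣ n`). [folklore] -/
theorem pmul_log_mul_apply_le {f g : ArithmeticFunction ℝ} (hf : ∀ n, 0 ≤ f n) (hg : ∀ n, 0 ≤ g n)
    (n : ℕ) : (f.pmul ArithmeticFunction.log * g) n ≤ ((f * g).pmul ArithmeticFunction.log) n := by
  rw [ArithmeticFunction.mul_apply, ArithmeticFunction.pmul_apply, ArithmeticFunction.mul_apply,
    ArithmeticFunction.log_apply, Finset.sum_mul]
  refine Finset.sum_le_sum fun x hx => ?_
  have hx1 : 0 < x.1 := Nat.pos_of_mem_divisors (Nat.fst_mem_divisors_of_mem_antidiagonal hx)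
  have hle : Real.log x.1 ≤ Real.log n := Real.log_le_log (by exact_mod_cast hx1)
    (by exact_mod_cast Nat.divisor_le (Nat.fst_mem_divisors_of_mem_antidiagonal hx))
  rw [ArithmeticFunction.pmul_apply, ArithmeticFunction.log_apply]
  calc f x.1 * Real.log x.1 * g x.2 = (f x.1 * g x.2) * Real.log x.1 := by ring
    _ ≤ (f x.1 * g x.2) * Real.log n := mul_le_mul_of_nonneg_left hle (mul_nonneg (hf _) (hg _))

/-- **`Λ_a * Λ_b ≤ Λ_{a+b}`** ([FriedlanderIwaniecPisa1978] Lemma 1 (ii), two factors): induction on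
`a` with `Λ_{a+1} = Λ_a log + Λ * Λ_a` (the derivation `h ↦ h log + Λ * h` is monotone and
satisfies `(∂f) * g ≤ ∂(f * g)` for `f, g ≥ 0`). [cite: FriedlanderIwaniecPisa1978, Lemma 1 (ii)] -/
theorem generalizedVonMangoldt_mul_apply_le (a b n : ℕ) :
    (generalizedVonMangoldt a * generalizedVonMangoldt b) n ≤ generalizedVonMangoldt (a + b) n := by
  induction a generalizing n with
  | zero => rw [generalizedVonMangoldt_zero, one_mul, zero_add]
  | succ a ih =>
    rw [generalizedVonMangoldt_succ, add_mul, ArithmeticFunction.add_apply,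
      show a + 1 + b = (a + b) + 1 by ring, generalizedVonMangoldt_succ, ArithmeticFunction.add_apply]
    have h0 : ∀ m, 0 ≤ (generalizedVonMangoldt a * generalizedVonMangoldt b) m := fun m => by
      rw [ArithmeticFunction.mul_apply]
      exact Finset.sum_nonneg fun x _ =>
        mul_nonneg (generalizedVonMangoldt_nonneg _ _) (generalizedVonMangoldt_nonneg _ _)
    refine add_le_add ?_ ?_
    · refine (pmul_log_mul_apply_le (generalizedVonMangoldt_nonneg a)
        (generalizedVonMangoldt_nonneg b) n).trans ?_
      rw [ArithmeticFunction.pmul_apply, ArithmeticFunction.pmul_apply, ArithmeticFunction.log_apply]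
      rcases Nat.eq_zero_or_pos n with rfl | hn
      · simp
      · exact mul_le_mul_of_nonneg_right (ih n) (Real.log_nonneg (by exact_mod_cast hn))
    · rw [mul_assoc]
      exact mul_apply_le_mul_apply (fun _ => ArithmeticFunction.vonMangoldt_nonneg) ih n

/-- `Λ_(k) ≥ 0`. [folklore] -/
theorem lambdaVec_apply_nonneg (ks : List ℕ) (n : ℕ) : 0 ≤ lambdaVec ks n := by
  induction ks generalizing n with
  | nil =>
    simp only [lambdaVec, List.map_nil, List.prod_nil, ArithmeticFunction.one_apply]
    split_ifs <;> norm_num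
  | cons a ks ih =>
    simp only [lambdaVec, List.map_cons, List.prod_cons, ArithmeticFunction.mul_apply]
    exact Finset.sum_nonneg fun x _ => mul_nonneg (generalizedVonMangoldt_nonneg _ _) (ih _)

/-- **[FriedlanderIwaniecPisa1978] Lemma 1 (ii)** for `K = ℚ`: `Λ_(k)(n) ≤ Λ_{|k|}(n)`.
[cite: FriedlanderIwaniecPisa1978, Lemma 1 (ii)] -/
theorem lambdaVec_le_sum (ks : List ℕ) (n : ℕ) : lambdaVec ks n ≤ generalizedVonMangoldt ks.sum n := by
  induction ks generalizing n with
  | nil => simp [lambdaVec, generalizedVonMangoldt_zero]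
  | cons a ks ih =>
    simp only [lambdaVec, List.map_cons, List.prod_cons, List.sum_cons]
    exact (mul_apply_le_mul_apply (generalizedVonMangoldt_nonneg a) ih n).trans
      (generalizedVonMangoldt_mul_apply_le a ks.sum n)

/-- `𝔏_(k) = μ * Λ_(k)` ([FriedlanderIwaniecPisa1978] p. 725, Definition; "in the case when `(k)` is
scalar" — i.e. `(k')` empty — "`𝔏_(k')` is just the Möbius function", p. 735). [cite: FriedlanderIwaniecPisa1978, p. 725 (Definition of 𝔏(k))] -/
def frakL (ks : List ℕ) : ArithmeticFunction ℝ := (μ : ArithmeticFunction ℝ) * lambdaVec ks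

/-- `𝔏` of the empty vector is `μ`. [folklore] -/
theorem frakL_nil : frakL [] = (μ : ArithmeticFunction ℝ) := by
  simp [frakL, lambdaVec]

/-- `|(μ * F)(n)| ≤ (ζ * F)(n)` for `F ≥ 0`. [folklore] -/
theorem abs_moebius_mul_apply_le {F : ArithmeticFunction ℝ} (hF : ∀ n, 0 ≤ F n) (n : ℕ) :
    |((μ : ArithmeticFunction ℝ) * F) n| ≤ ((ζ : ArithmeticFunction ℝ) * F) n := by
  rw [ArithmeticFunction.mul_apply, ArithmeticFunction.mul_apply]
  refine (Finset.abs_sum_le_sum_abs _ _).trans (Finset.sum_le_sum fun x hx => ?_)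
  have hx1 : x.1 ≠ 0 := (Nat.pos_of_mem_divisors (Nat.fst_mem_divisors_of_mem_antidiagonal hx)).ne'
  rw [abs_mul, abs_of_nonneg (hF _), ArithmeticFunction.natCoe_apply,
    ArithmeticFunction.zeta_apply_ne hx1, Nat.cast_one, one_mul, ArithmeticFunction.intCoe_apply]
  refine mul_le_of_le_one_left (hF _) ?_
  rw [← Int.cast_abs]
  exact_mod_cast ArithmeticFunction.abs_moebius_le_one

/-- `(log.ppow j) d = (log d)^j` for `d ≥ 1` (including `j = 0`, where `ppow 0 = ζ`). [folklore] -/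
theorem log_ppow_apply_of_pos' (j : ℕ) {d : ℕ} (hd : 0 < d) :
    ArithmeticFunction.log.ppow j d = Real.log d ^ j := by
  rcases Nat.eq_zero_or_pos j with rfl | hj
  · rw [ArithmeticFunction.ppow_zero, pow_zero, ArithmeticFunction.natCoe_apply,
      ArithmeticFunction.zeta_apply_ne hd.ne', Nat.cast_one]
  · rw [ArithmeticFunction.ppow_apply hj, ArithmeticFunction.log_apply]

/-- **[FriedlanderIwaniecPisa1978] Lemma 1 (iii)** for `K = ℚ`: `|𝔏_(k)(n)| ≤ (log n)^{|k|}` (`n ≥ 1`;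
`|μ * Λ_(k)| ≤ ζ * Λ_(k) ≤ ζ * Λ_{|k|} = log^{|k|}`). [cite: FriedlanderIwaniecPisa1978, Lemma 1 (iii)] -/
theorem abs_frakL_le (ks : List ℕ) {n : ℕ} (hn : 0 < n) : |frakL ks n| ≤ Real.log n ^ ks.sum := by
  refine (abs_moebius_mul_apply_le (lambdaVec_apply_nonneg ks) n).trans ?_
  refine (mul_apply_le_mul_apply (fun m => ?_) (lambdaVec_le_sum ks) n).trans ?_
  · rw [ArithmeticFunction.natCoe_apply]; exact_mod_cast Nat.zero_le _
  · rw [coe_zeta_mul_generalizedVonMangoldt, log_ppow_apply_of_pos' _ hn]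

/-- `|𝔏_(k)(d)| ≤ (log x)^{|k|}` for `1 ≤ d ≤ x`. [folklore] -/
theorem abs_frakL_le_log (ks : List ℕ) {d : ℕ} (hd : 0 < d) {x : ℝ} (hdx : (d : ℝ) ≤ x) :
    |frakL ks d| ≤ Real.log x ^ ks.sum :=
  (abs_frakL_le ks hd).trans (pow_le_pow_left₀ (Real.log_nonneg (by exact_mod_cast hd))
    (Real.log_le_log (by exact_mod_cast hd) hdx) _)

/-! ### The dissection `∑ a_n Λ_(k)(n) = Σ₀ + Σ₁ + Σ₂` ([FriedlanderIwaniecPisa1978] p. 735) -/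

/-- `Λ_((k'),a) = 𝔏_(k') * log^a`: `Λ_a * Λ_(k') = (μ * log^a) * Λ_(k') = (μ * Λ_(k')) * log^a`.
[cite: FriedlanderIwaniecPisa1978, p. 735] -/
theorem lambdaVec_cons_eq (ks' : List ℕ) (a : ℕ) :
    lambdaVec (a :: ks') = frakL ks' * ArithmeticFunction.log.ppow a := by
  simp only [lambdaVec, List.map_cons, List.prod_cons, frakL, generalizedVonMangoldt]
  ring

/-- Pointwise: `Λ_((k'),a)(n) = ∑_{de = n} 𝔏_(k')(d) (log e)^a` for `a ≥ 1`. [cite: FriedlanderIwaniecPisa1978, p. 735] -/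
theorem lambdaVec_cons_apply (ks' : List ℕ) {a : ℕ} (ha : 0 < a) (n : ℕ) :
    lambdaVec (a :: ks') n = ∑ e ∈ n.divisorsAntidiagonal, frakL ks' e.1 * Real.log e.2 ^ a := by
  rw [lambdaVec_cons_eq, ArithmeticFunction.mul_apply]
  refine Finset.sum_congr rfl fun e _ => ?_
  rw [ArithmeticFunction.ppow_apply ha, ArithmeticFunction.log_apply]

/-- `Σ₀ = ∑_{n ≤ x, (n,P(z)) > 1} a_n Λ_(k)(n)` ([FriedlanderIwaniecPisa1978] p. 735). [cite: FriedlanderIwaniecPisa1978, p. 735 (Σ₀)] -/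
def sigma0V (A : SieveSequence) (ks : List ℕ) (x z : ℝ) : ℝ :=
  ∑ n ∈ (Ioc 0 ⌊x⌋₊).filter (fun n : ℕ => ¬ n.Coprime (primesProdBelow z)), lambdaVec ks n * A.a n

/-- The lower part `∑_{d ∣ n, d < y} 𝔏_(k')(d)(log n/d)^a`. [cite: FriedlanderIwaniecPisa1978, p. 735 (Σ₁)] -/
def truncLowerV (ks' : List ℕ) (a : ℕ) (y : ℝ) (n : ℕ) : ℝ :=
  ∑ e ∈ n.divisorsAntidiagonal with ((e.1 : ℕ) : ℝ) < y, frakL ks' e.1 * Real.log e.2 ^ a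

/-- The upper part `∑_{d ∣ n, d ≥ y} 𝔏_(k')(d)(log n/d)^a`. [cite: FriedlanderIwaniecPisa1978, p. 735 (Σ₂)] -/
def truncUpperV (ks' : List ℕ) (a : ℕ) (y : ℝ) (n : ℕ) : ℝ :=
  ∑ e ∈ n.divisorsAntidiagonal with y ≤ ((e.1 : ℕ) : ℝ), frakL ks' e.1 * Real.log e.2 ^ a

/-- `Λ_((k'),a)(n) = (lower) + (upper)` for `a ≥ 1`. [folklore] -/
theorem truncLowerV_add_truncUpperV (ks' : List ℕ) {a : ℕ} (ha : 0 < a) (y : ℝ) (n : ℕ) :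
    truncLowerV ks' a y n + truncUpperV ks' a y n = lambdaVec (a :: ks') n := by
  rw [lambdaVec_cons_apply ks' ha, truncLowerV, truncUpperV]
  have h : (n.divisorsAntidiagonal.filter fun e : ℕ × ℕ => y ≤ ((e.1 : ℕ) : ℝ)) =
      n.divisorsAntidiagonal.filter fun e : ℕ × ℕ => ¬ ((e.1 : ℕ) : ℝ) < y :=
    Finset.filter_congr fun e _ => by rw [not_lt]
  rw [h]
  exact Finset.sum_filter_add_sum_filter_not n.divisorsAntidiagonal (fun e : ℕ × ℕ => ((e.1 : ℕ) : ℝ) < y) _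

/-- `Σ₁ = ∑_{n ≤ x, (n,P(z))=1} a_n ∑_{d ∣ n, d < y} 𝔏_(k')(d)(log n/d)^a` ([FriedlanderIwaniecPisa1978] p. 735). [cite: FriedlanderIwaniecPisa1978, p. 735 (Σ₁)] -/
def sigma1V (A : SieveSequence) (ks' : List ℕ) (a : ℕ) (x y z : ℝ) : ℝ :=
  ∑ n ∈ (Ioc 0 ⌊x⌋₊).filter (fun n : ℕ => n.Coprime (primesProdBelow z)), truncLowerV ks' a y n * A.a n

/-- `Σ₂ = ∑_{n ≤ x, (n,P(z))=1} a_n ∑_{d ∣ n, d ≥ y} 𝔏_(k')(d)(log n/d)^a` ([FriedlanderIwaniecPisa1978] p. 735). [cite: FriedlanderIwaniecPisa1978, p. 735 (Σ₂)] -/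
def sigma2V (A : SieveSequence) (ks' : List ℕ) (a : ℕ) (x y z : ℝ) : ℝ :=
  ∑ n ∈ (Ioc 0 ⌊x⌋₊).filter (fun n : ℕ => n.Coprime (primesProdBelow z)), truncUpperV ks' a y n * A.a n

/-- **The dissection** ([FriedlanderIwaniecPisa1978] p. 735): for `a ≥ 1`,
`∑_{n ≤ x} a_n Λ_((k'),a)(n) = Σ₀ + Σ₁ + Σ₂`. [cite: FriedlanderIwaniecPisa1978, p. 735] -/
theorem sum_eq_sigma0V_add_sigma1V_add_sigma2V (A : SieveSequence) (ks' : List ℕ) {a : ℕ} (ha : 0 < a)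
    (x y z : ℝ) :
    ∑ n ∈ Ioc 0 ⌊x⌋₊, lambdaVec (a :: ks') n * A.a n =
      sigma0V A (a :: ks') x z + sigma1V A ks' a x y z + sigma2V A ks' a x y z := by
  rw [sigma0V, sigma1V, sigma2V, add_assoc, ← Finset.sum_add_distrib]
  have h : ∀ n ∈ (Ioc 0 ⌊x⌋₊).filter (fun n : ℕ => n.Coprime (primesProdBelow z)),
      truncLowerV ks' a y n * A.a n + truncUpperV ks' a y n * A.a n = lambdaVec (a :: ks') n * A.a n :=
    fun n _ => by rw [← add_mul, truncLowerV_add_truncUpperV ks' ha]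
  rw [Finset.sum_congr rfl h, add_comm]
  exact (Finset.sum_filter_add_sum_filter_not _ _ _).symm

/-- `Σ₀ ≥ 0`. [folklore] -/
theorem sigma0V_nonneg (A : SieveSequence) (ks : List ℕ) (x z : ℝ) : 0 ≤ sigma0V A ks x z :=
  Finset.sum_nonneg fun n _ => mul_nonneg (lambdaVec_apply_nonneg ks n) (A.a_nonneg n)

/-- **Lemma 10 for vectors, from the scalar case**: `Σ₀((k)) ≤ Σ₀(|k|)` since `Λ_(k) ≤ Λ_{|k|}` and
`a_n ≥ 0`; so the tree's `FI1978_lemma10_holds` (for `|k| ≥ 2`) bounds the vector `Σ₀`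
([FriedlanderIwaniecPisa1978] Lemma 10: "`Σ₀ ≪ A(x)(log x)^{|k|−2} log z + o(A(x)(log x)^{|k|−1})`").
[cite: FriedlanderIwaniecPisa1978, Lemma 10] -/
theorem sigma0V_le_sigma0 (A : SieveSequence) (ks : List ℕ) (x z : ℝ) :
    sigma0V A ks x z ≤ sigma0 A ks.sum x z :=
  Finset.sum_le_sum fun n _ => mul_le_mul_of_nonneg_right (lambdaVec_le_sum ks n) (A.a_nonneg n)

/-- The main-term functional for vectors:
`F = ∏_{p<z}(1 − 1/p) ∑_{d<y, (d,P(z))=1} 𝔏_(k')(d) d⁻¹ (log x/d)^a` ([FriedlanderIwaniecPisa1978]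
Lemma 12); for `(k')` empty it is the tree's `mainTermF a`. [cite: FriedlanderIwaniecPisa1978, Lemma 12 (F)] -/
def mainTermFV (ks' : List ℕ) (a : ℕ) (x y z : ℝ) : ℝ :=
  (∏ p ∈ Nat.primesBelow ⌈z⌉₊, (1 - (p : ℝ)⁻¹)) *
    ∑ d ∈ (Ico 1 ⌈y⌉₊).filter (fun d : ℕ => d.Coprime (primesProdBelow z)),
      frakL ks' d / d * Real.log (x / d) ^ a

/-! ### [FriedlanderIwaniecPisa1978] Lemma 11 for vectors: `Σ₂` against sifted subsequence sums -/

/-- For `n ≤ x`, `0 < y ≤ x`: `|∑_{d ∣ n, d ≥ y} 𝔏_(k')(d)(log n/d)^a| ≤ (log x)^{|k'|}(log x/y)^a #{m ∣ n : m ≤ x/y}`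
("Using Lemma 1 we get …", first display of the proof of Lemma 11, p. 738). [cite: FriedlanderIwaniecPisa1978, Lemma 11 (proof)] -/
theorem abs_truncUpperV_le (ks' : List ℕ) (a : ℕ) {x y : ℝ} (hx1 : 1 ≤ x) (hy : 0 < y) (hyx : y ≤ x)
    {n : ℕ} (hnx : (n : ℝ) ≤ x) :
    |truncUpperV ks' a y n| ≤
      Real.log x ^ ks'.sum * Real.log (x / y) ^ a * #(n.divisors.filter (fun m : ℕ => (m : ℝ) ≤ x / y)) := by
  have hlog0 : 0 ≤ Real.log (x / y) := Real.log_nonneg ((one_le_div hy).mpr hyx)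
  have hlogx0 : 0 ≤ Real.log x := Real.log_nonneg hx1
  set T := n.divisorsAntidiagonal.filter (fun e : ℕ × ℕ => y ≤ ((e.1 : ℕ) : ℝ)) with hT
  have hmem : ∀ e ∈ T, e.2 ∈ n.divisors.filter (fun m : ℕ => (m : ℝ) ≤ x / y) ∧ 1 ≤ e.2 ∧
      0 < e.1 ∧ (e.1 : ℝ) ≤ x := by
    intro e he
    obtain ⟨he', hye⟩ := Finset.mem_filter.mp he
    obtain ⟨hprod, hn⟩ := Nat.mem_divisorsAntidiagonal.mp he'
    have he2 : e.2 ≠ 0 := fun h => hn (by rw [← hprod, h, mul_zero])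
    have he1 : e.1 ≠ 0 := fun h => hn (by rw [← hprod, h, zero_mul])
    have he1pos : (0 : ℝ) < e.1 := by exact_mod_cast Nat.pos_of_ne_zero he1
    have he1n : e.1 ≤ n := Nat.le_of_dvd (Nat.pos_of_ne_zero hn) ⟨e.2, hprod.symm⟩
    refine ⟨Finset.mem_filter.mpr ⟨Nat.mem_divisors.mpr ⟨⟨e.1, by rw [mul_comm, hprod]⟩, hn⟩, ?_⟩,
      Nat.one_le_iff_ne_zero.mpr he2, Nat.pos_of_ne_zero he1, (Nat.cast_le.mpr he1n).trans hnx⟩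
    have h2 : (e.2 : ℝ) = n / e.1 := by
      rw [eq_div_iff he1pos.ne', ← Nat.cast_mul, mul_comm, hprod]
    rw [h2, div_le_div_iff₀ he1pos hy]
    have hx0 : 0 ≤ x := hy.le.trans hyx
    calc (n : ℝ) * y ≤ x * y := mul_le_mul_of_nonneg_right hnx hy.le
      _ ≤ x * e.1 := mul_le_mul_of_nonneg_left hye hx0
  have hbound : ∀ e ∈ T, |frakL ks' e.1 * Real.log e.2 ^ a| ≤ Real.log x ^ ks'.sum * Real.log (x / y) ^ a := by
    intro e he
    obtain ⟨hm, h1, he1, he1x⟩ := hmem e he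
    have hmx : (e.2 : ℝ) ≤ x / y := (Finset.mem_filter.mp hm).2
    have hl0 : 0 ≤ Real.log e.2 := Real.log_natCast_nonneg _
    have hl : Real.log e.2 ≤ Real.log (x / y) := Real.log_le_log (by exact_mod_cast h1) hmx
    rw [abs_mul, abs_of_nonneg (pow_nonneg hl0 _)]
    exact mul_le_mul (abs_frakL_le_log ks' he1 he1x) (pow_le_pow_left₀ hl0 hl _) (pow_nonneg hl0 _)
      (pow_nonneg hlogx0 _)
  have hcard : #T ≤ #(n.divisors.filter (fun m : ℕ => (m : ℝ) ≤ x / y)) := by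
    refine Finset.card_le_card_of_injOn Prod.snd (fun e he => (hmem e he).1) ?_
    intro e he e' he' h
    obtain ⟨hprod, hn⟩ := Nat.mem_divisorsAntidiagonal.mp (Finset.mem_filter.mp he).1
    obtain ⟨hprod', -⟩ := Nat.mem_divisorsAntidiagonal.mp (Finset.mem_filter.mp he').1
    have h2 : e.2 ≠ 0 := fun h0 => hn (by rw [← hprod, h0, mul_zero])
    change e.2 = e'.2 at h
    have h1 : e.1 = e'.1 := by
      apply Nat.eq_of_mul_eq_mul_right (Nat.pos_of_ne_zero h2)
      rw [hprod, h, hprod']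
    exact Prod.ext h1 h
  rw [truncUpperV]
  refine (Finset.abs_sum_le_sum_abs _ _).trans ((Finset.sum_le_sum hbound).trans ?_)
  rw [Finset.sum_const, nsmul_eq_mul, mul_comm]
  exact mul_le_mul_of_nonneg_left (by exact_mod_cast hcard) (by positivity)

/-- **`Σ₂` against the sifted subsequences, vector case** ([FriedlanderIwaniecPisa1978] Lemma 11,
first step): `|Σ₂| ≤ (log x)^{|k'|}(log x/y)^a ∑_{m ≤ x/y, (m,P(z))=1} S(𝒜_m, z; x)` (as in the
tree's scalar `abs_sigma2_le`, with Lemma 1 (iii) for `|𝔏_(k')(d)|`). [cite: FriedlanderIwaniecPisa1978, Lemma 11 (proof)] -/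
theorem abs_sigma2V_le (A : SieveSequence) (ks' : List ℕ) (a : ℕ) {x y : ℝ} (z : ℝ) (hx1 : 1 ≤ x)
    (hy : 0 < y) (hyx : y ≤ x) :
    |sigma2V A ks' a x y z| ≤ Real.log x ^ ks'.sum * Real.log (x / y) ^ a *
      ∑ m ∈ (Ioc 0 ⌊x / y⌋₊).filter (fun m : ℕ => m.Coprime (primesProdBelow z)),
        (A.restrictDvd m).sifted x (primesProdBelow z) := by
  have hx0 : 0 ≤ x := hy.le.trans hyx
  have hxy0 : 0 ≤ x / y := div_nonneg hx0 hy.le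
  set C := Real.log x ^ ks'.sum * Real.log (x / y) ^ a with hC
  have hC0 : 0 ≤ C := by
    have hlog0 : 0 ≤ Real.log (x / y) := Real.log_nonneg ((one_le_div hy).mpr hyx)
    have hlogx0 : 0 ≤ Real.log x := Real.log_nonneg hx1
    positivity
  set P := primesProdBelow z with hP
  set N := ⌊x⌋₊ with hN
  set D := ⌊x / y⌋₊ with hD
  set a' : ℕ → ℝ := fun n => if n.Coprime P then A.a n else 0 with ha'
  have hstep1 : |sigma2V A ks' a x y z| ≤ C * ∑ n ∈ Ioc 0 N, a' n * ∑ m ∈ n.divisors with m ≤ D, (1 : ℝ) := by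
    rw [sigma2V, ← hP, ← hN, Finset.mul_sum]
    refine (Finset.abs_sum_le_sum_abs _ _).trans ?_
    rw [← Finset.sum_filter_add_sum_filter_not (Ioc 0 N) (fun n : ℕ => n.Coprime P)
      (fun n => C * (a' n * ∑ m ∈ n.divisors with m ≤ D, (1 : ℝ)))]
    have hzero : ∑ n ∈ (Ioc 0 N).filter (fun n : ℕ => ¬ n.Coprime P),
        C * (a' n * ∑ m ∈ n.divisors with m ≤ D, (1 : ℝ)) = 0 := by
      refine Finset.sum_eq_zero fun n hn => ?_
      rw [ha']
      simp only
      rw [if_neg (Finset.mem_filter.mp hn).2, zero_mul, mul_zero]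
    rw [hzero, add_zero]
    refine Finset.sum_le_sum fun n hn => ?_
    obtain ⟨hn', hcop⟩ := Finset.mem_filter.mp hn
    have hnx : (n : ℝ) ≤ x := le_trans (by exact_mod_cast (Finset.mem_Ioc.mp hn').2) (Nat.floor_le hx0)
    rw [abs_mul, abs_of_nonneg (A.a_nonneg n), ha']
    simp only
    rw [if_pos hcop]
    have hcard : ((#(n.divisors.filter (fun m : ℕ => (m : ℝ) ≤ x / y)) : ℕ) : ℝ) =
        ∑ m ∈ n.divisors with m ≤ D, (1 : ℝ) := by
      rw [Finset.sum_const, nsmul_eq_mul, mul_one]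
      congr 2
      ext m
      simp only [Finset.mem_filter, hD]
      exact and_congr_right fun _ => (Nat.le_floor_iff hxy0).symm
    calc |truncUpperV ks' a y n| * A.a n
        ≤ (C * #(n.divisors.filter (fun m : ℕ => (m : ℝ) ≤ x / y))) * A.a n := by
          refine mul_le_mul_of_nonneg_right ?_ (A.a_nonneg n)
          rw [hC]
          exact abs_truncUpperV_le ks' a hx1 hy hyx hnx
      _ = C * (A.a n * ∑ m ∈ n.divisors with m ≤ D, (1 : ℝ)) := by rw [← hcard]; ring
  refine hstep1.trans (mul_le_mul_of_nonneg_left (le_of_eq ?_) hC0)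
  rw [sum_mul_sum_divisors_le_eq a' (fun _ => (1 : ℝ)) N D]
  simp only [one_mul]
  have hinner : ∀ m : ℕ, ∑ n ∈ (Ioc 0 N).filter (m ∣ ·), a' n = (A.restrictDvd m).sifted x P := by
    intro m
    rw [sifted_restrictDvd, ← hN, ha', Finset.sum_filter, Finset.sum_filter]
    refine Finset.sum_congr rfl fun n _ => ?_
    by_cases hmn : m ∣ n
    · by_cases hc : n.Coprime P
      · rw [if_pos hmn, if_pos hc, if_pos ⟨hc, hmn⟩]
      · rw [if_pos hmn, if_neg hc, if_neg (fun h => hc h.1)]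
    · rw [if_neg hmn, if_neg (fun h => hmn h.2)]
  simp_rw [hinner]
  symm
  refine Finset.sum_subset (Finset.filter_subset _ _) fun m hm hmnot => ?_
  have hmc : ¬ m.Coprime P := fun h => hmnot (Finset.mem_filter.mpr ⟨hm, h⟩)
  rw [sifted_restrictDvd]
  refine Finset.sum_eq_zero fun n hn => ?_
  obtain ⟨-, hc, hmn⟩ := Finset.mem_filter.mp hn
  exact absurd (Nat.Coprime.coprime_dvd_left hmn hc) hmc

/-! ### [FriedlanderIwaniecPisa1978] Lemma 11 for vectors -/

/-- **[FriedlanderIwaniecPisa1978] Lemma 11 for vectors** (p. 738: "If `zy < x` and `z x^{1/2} < y < x^{1−ε}`,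
then `Σ₂ ≪ A(x)(log x/y)^{a+1}(log x)^{|k'|}(log z)^{−2}`, where the implied constant may depend on
`f`, `C`, and `ε`"): the tree's scalar proof (`FI1978_lemma11_of_fundamentalLemma`: the fundamental
lemma at level `z²` for each `𝒜_m`, (A₂) for the moduli `νm ≤ z² x/y < x^{1−ε}`, Lemmata 7 and 8)
after the vector first step `abs_sigma2V_le`; as there, the dependence on `ε` is confined to the
threshold in `x`. [cite: FriedlanderIwaniecPisa1978, Lemma 11] -/
theorem lemma11V (A : SieveSequence) (hA : A.IsBombieriSequence) (ks' : List ℕ) (a : ℕ) :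
    ∃ C : ℝ, ∀ ε : ℝ, 0 < ε → ∀ᶠ x : ℝ in atTop, ∀ y z : ℝ, 2 ≤ z → z * y < x →
      z * Real.sqrt x < y → y < x ^ (1 - ε) →
        |sigma2V A ks' a x y z| ≤
          C * A.size x * Real.log x ^ ks'.sum * Real.log (x / y) ^ (a + 1) / Real.log z ^ 2 := by
  have hFL := SieveSequence.fundamental_lemma_uniform_holds
  have hsize := hA.1
  have hA0 : ∀ x, 0 ≤ A.size x := SieveSequence.size_nonneg_of_size_eq hsize
  rcases density_nonneg_or_size_eq_zero A hA with hg | hzero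
  swap
  · -- degenerate case: all `a_n` vanish, `Σ₂ = 0`
    refine ⟨0, fun ε hε => Filter.Eventually.of_forall fun x y z _ _ _ _ => ?_⟩
    have h0 : ∑ n ∈ Ioc 0 ⌊x⌋₊, A.a n = 0 := by
      have := hzero x
      rwa [hsize x, SieveSequence.congrSum,
        Finset.filter_true_of_mem (fun n _ => one_dvd n)] at this
    have ha : ∀ n ∈ Ioc 0 ⌊x⌋₊, A.a n = 0 :=
      (Finset.sum_eq_zero_iff_of_nonneg fun n _ => A.a_nonneg n).mp h0
    have hs : sigma2V A ks' a x y z = 0 := by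
      rw [sigma2V]
      exact Finset.sum_eq_zero fun n hn => by rw [ha n (Finset.mem_filter.mp hn).1, mul_zero]
    rw [hs, abs_zero]
    simp
  -- the constants: sieve dimension, fundamental lemma, Lemma 7, Lemma 8
  obtain ⟨K, hK⟩ := hasSieveDimension A hA hg
  obtain ⟨CF, hCF0, hFL'⟩ := hFL 1 K
  obtain ⟨H, -, -, η, -, C₇, h7⟩ := FI1978_lemma7_rat A hA
  obtain ⟨C₈, h8⟩ := FI1978_lemma8_rat A hA.2.1 hA.2.2.2.2.2
  set C₇' := max C₇ 1 with hC₇'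
  set C₈' := max C₈ 1 with hC₈'
  have hC₇'0 : 0 ≤ C₇' := zero_le_one.trans (le_max_right _ _)
  have hC₈'0 : 0 ≤ C₈' := zero_le_one.trans (le_max_right _ _)
  refine ⟨(1 + CF) * C₇' * C₈' + 1, fun ε hε => ?_⟩
  -- (A₂) with this `ε` and `B = 3`
  obtain ⟨C₂, hC₂⟩ := hA.2.2.1 ε hε ((3 : ℕ) : ℝ) (by norm_num)
  filter_upwards [hC₂, eventually_ge_atTop (1 : ℝ),
    Real.tendsto_log_atTop.eventually_ge_atTop (max 1 C₂)] with x hx2 hx1 hxlog y z hz hzy hzx hyx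
  -- the parameters
  have hx0 : 0 < x := by linarith
  have hlogx1 : 1 ≤ Real.log x := (le_max_left _ _).trans hxlog
  have hC₂log : C₂ ≤ Real.log x := (le_max_right _ _).trans hxlog
  have hz0 : 0 < z := by linarith
  have hz1 : 1 < z := by linarith
  have hsqrt1 : 1 ≤ Real.sqrt x := by
    rw [← Real.sqrt_one]
    exact Real.sqrt_le_sqrt hx1
  have hsqrt0 : 0 < Real.sqrt x := by linarith
  have hy2 : 2 ≤ y := by nlinarith
  have hy0 : 0 < y := by linarith
  have hy1 : 1 ≤ y := by linarith
  have hyx' : y ≤ x := by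
    refine hyx.le.trans ?_
    calc x ^ (1 - ε) ≤ x ^ (1 : ℝ) := Real.rpow_le_rpow_of_exponent_le hx1 (by linarith)
      _ = x := Real.rpow_one x
  have hzxy : z < x / y := by rwa [lt_div_iff₀ hy0]
  have hxy0 : 0 ≤ x / y := div_nonneg hx0.le hy0.le
  have hzx' : z ≤ x := hzxy.le.trans (div_le_self hx0.le hy1)
  have hlogz : 0 < Real.log z := Real.log_pos hz1
  have hlogxy : Real.log z ≤ Real.log (x / y) := Real.log_le_log hz0 hzxy.le
  have hlogxy0 : 0 < Real.log (x / y) := hlogz.trans_le hlogxy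
  have hlogzx : Real.log z ≤ Real.log x := Real.log_le_log hz0 hzx'
  -- the level: `z² · x/y < z √x < y < x^{1−ε}`
  have hlevel : x / y * z ^ 2 < x ^ (1 - ε) := by
    have h1 : x / y * z ^ 2 < z * Real.sqrt x := by
      rw [div_mul_eq_mul_div, div_lt_iff₀ hy0]
      have hsx : Real.sqrt x ^ 2 = x := Real.sq_sqrt hx0.le
      have h2 : Real.sqrt x * z < y := by linarith
      calc x * z ^ 2 = (Real.sqrt x * z) * (z * Real.sqrt x) := by
            linear_combination (-(z ^ 2)) * hsx
        _ < y * (z * Real.sqrt x) := mul_lt_mul_of_pos_right h2 (mul_pos hz0 hsqrt0)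
        _ = z * Real.sqrt x * y := by ring
    exact h1.trans (hzx.trans hyx)
  set P := primesProdBelow z with hP
  set V := A.densityProduct P with hV
  have hVle : V ≤ C₇' / Real.log z :=
    (h7 z hz).2.trans (div_le_div_of_nonneg_right (le_max_left _ _) hlogz.le)
  have hV0 : 0 ≤ V := by
    rw [hV, densityProduct_primesProdBelow]
    exact Finset.prod_nonneg fun p hp =>
      (sub_pos.mpr (hA.2.1.2 p (Nat.prime_of_mem_primesBelow hp).one_lt)).le
  have hAx := hA0 x
  -- Step 1: `|Σ₂| ≤ (log x/y)^k ∑_m S(𝒜_m, z; x)`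
  have h1 := abs_sigma2V_le A ks' a z hx1 hy0 hyx'
  rw [← hP] at h1
  -- Step 2: the fundamental lemma (upper half) for each `𝒜_m`, `(m, P(z)) = 1`, at level `z²`
  have hFLm : ∀ m ∈ (Ioc 0 ⌊x / y⌋₊).filter (fun m : ℕ => m.Coprime P),
      (A.restrictDvd m).sifted x P ≤ (1 + CF) * A.size x * V * |A.density m| +
        ∑ d ∈ P.divisors.filter (fun d : ℕ => (d : ℝ) ≤ z ^ 2), |A.remainder (m * d) x| := by
    intro m hm
    obtain ⟨hm', hmP⟩ := Finset.mem_filter.mp hm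
    have hm1 : 1 ≤ m := (Finset.mem_Ioc.mp hm').1
    have hgm : 0 ≤ A.density m := hg m hm1
    have hsz : 0 ≤ A.density m * A.size x := mul_nonneg hgm hAx
    have hzz : z ≤ z ^ 2 := by nlinarith
    have h : |(A.restrictDvd m).sifted x P - A.density m * A.size x * V| ≤
        CF * (A.density m * A.size x) * V * Real.exp (-(Real.log (z ^ 2) / Real.log z)) +
          ∑ d ∈ P.divisors.filter (fun d : ℕ => (d : ℝ) ≤ z ^ 2),
            |(A.restrictDvd m).remainder d x| :=
      hFL' (A.restrictDvd m) hK x z (z ^ 2) hz hzz hsz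
    have hrem : ∑ d ∈ P.divisors.filter (fun d : ℕ => (d : ℝ) ≤ z ^ 2),
        |(A.restrictDvd m).remainder d x| =
        ∑ d ∈ P.divisors.filter (fun d : ℕ => (d : ℝ) ≤ z ^ 2), |A.remainder (m * d) x| := by
      refine Finset.sum_congr rfl fun d hd => ?_
      have hdP : d ∣ P := Nat.dvd_of_mem_divisors (Finset.mem_filter.mp hd).1
      rw [remainder_restrictDvd A (hmP.coprime_dvd_right hdP)]
    rw [hrem] at h
    have hexp : Real.exp (-(Real.log (z ^ 2) / Real.log z)) ≤ 1 := by
      rw [Real.exp_le_one_iff, neg_nonpos]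
      exact div_nonneg (Real.log_nonneg (by nlinarith)) hlogz.le
    have hup := (abs_sub_le_iff.mp h).1
    have hgAV : 0 ≤ CF * (A.density m * A.size x) * V := mul_nonneg (mul_nonneg hCF0.le hsz) hV0
    have hmain : A.density m * A.size x * V +
        CF * (A.density m * A.size x) * V * Real.exp (-(Real.log (z ^ 2) / Real.log z)) ≤
        (1 + CF) * A.size x * V * |A.density m| := by
      rw [abs_of_nonneg hgm]
      calc A.density m * A.size x * V +
            CF * (A.density m * A.size x) * V * Real.exp (-(Real.log (z ^ 2) / Real.log z))
          ≤ A.density m * A.size x * V + CF * (A.density m * A.size x) * V * 1 := by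
            gcongr
        _ = (1 + CF) * A.size x * V * A.density m := by ring
    linarith
  -- Step 3: summing over `m`: Lemma 8 for the main terms, rearrangement + (A₂) for the remainders
  have h8' : ∑ m ∈ (Ioc 0 ⌊x / y⌋₊).filter (fun m : ℕ => m.Coprime P), |A.density m| ≤
      C₈' * Real.log (x / y) / Real.log z := by
    refine (h8 (x / y) z hz hzxy.le).trans ?_
    exact div_le_div_of_nonneg_right (mul_le_mul_of_nonneg_right (le_max_left _ _) hlogxy0.le)
      hlogz.le
  have hR : ∑ m ∈ (Ioc 0 ⌊x / y⌋₊).filter (fun m : ℕ => m.Coprime P),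
      ∑ d ∈ P.divisors.filter (fun d : ℕ => (d : ℝ) ≤ z ^ 2), |A.remainder (m * d) x| ≤
      C₂ * A.size x / Real.log x ^ 3 := by
    have hM : ∀ m ∈ (Ioc 0 ⌊x / y⌋₊).filter (fun m : ℕ => m.Coprime P), m ≠ 0 ∧ m.Coprime P :=
      fun m hm => ⟨(Finset.mem_Ioc.mp (Finset.mem_filter.mp hm).1).1.ne',
        (Finset.mem_filter.mp hm).2⟩
    have hL : ∀ m ∈ (Ioc 0 ⌊x / y⌋₊).filter (fun m : ℕ => m.Coprime P),
        (m : ℝ) * z ^ 2 < x ^ (1 - ε) := by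
      intro m hm
      have hmX : (m : ℝ) ≤ x / y :=
        (Nat.cast_le.mpr (Finset.mem_Ioc.mp (Finset.mem_filter.mp hm).1).2).trans
          (Nat.floor_le hxy0)
      exact (mul_le_mul_of_nonneg_right hmX (sq_nonneg z)).trans_lt hlevel
    have hre := sum_coprime_sum_divisors_le (primesProdBelow_ne_zero z)
      (fun q => |A.remainder q x|) (fun q => abs_nonneg _) _ hM (z ^ 2) (x ^ (1 - ε)) hL
    refine hre.trans ?_
    have := hx2 (fun _ => x) fun _ => le_rfl
    rwa [Real.rpow_natCast] at this
  have hsumS : ∑ m ∈ (Ioc 0 ⌊x / y⌋₊).filter (fun m : ℕ => m.Coprime P),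
      (A.restrictDvd m).sifted x P ≤
      (1 + CF) * A.size x * V * (C₈' * Real.log (x / y) / Real.log z) +
        C₂ * A.size x / Real.log x ^ 3 := by
    refine (Finset.sum_le_sum hFLm).trans ?_
    rw [Finset.sum_add_distrib, ← Finset.mul_sum]
    refine add_le_add (mul_le_mul_of_nonneg_left h8' ?_) hR
    exact mul_nonneg (mul_nonneg (by linarith) hAx) hV0
  -- Step 4: arithmetic
  have hT1 : (1 + CF) * A.size x * V * (C₈' * Real.log (x / y) / Real.log z) ≤
      (1 + CF) * C₇' * C₈' * A.size x * Real.log (x / y) / Real.log z ^ 2 := by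
    have hnn : 0 ≤ (1 + CF) * A.size x * (C₈' * Real.log (x / y) / Real.log z) :=
      mul_nonneg (mul_nonneg (by linarith) hAx)
        (div_nonneg (mul_nonneg hC₈'0 hlogxy0.le) hlogz.le)
    calc (1 + CF) * A.size x * V * (C₈' * Real.log (x / y) / Real.log z)
        = (1 + CF) * A.size x * (C₈' * Real.log (x / y) / Real.log z) * V := by ring
      _ ≤ (1 + CF) * A.size x * (C₈' * Real.log (x / y) / Real.log z) * (C₇' / Real.log z) :=
          mul_le_mul_of_nonneg_left hVle hnn
      _ = (1 + CF) * C₇' * C₈' * A.size x * Real.log (x / y) / Real.log z ^ 2 := by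
          field_simp
  have hT2 : C₂ * A.size x / Real.log x ^ 3 ≤ A.size x * Real.log (x / y) / Real.log z ^ 2 := by
    have hlx0 : 0 < Real.log x := by linarith
    have ha : C₂ / Real.log x ^ 3 ≤ 1 / Real.log x := by
      rw [div_le_div_iff₀ (pow_pos hlx0 3) hlx0]
      have : C₂ * Real.log x ≤ Real.log x * Real.log x := mul_le_mul_of_nonneg_right hC₂log hlx0.le
      nlinarith
    have hb : 1 / Real.log x ≤ 1 / Real.log z := one_div_le_one_div_of_le hlogz hlogzx
    have hc : 1 / Real.log z ≤ Real.log (x / y) / Real.log z ^ 2 := by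
      rw [div_le_div_iff₀ hlogz (pow_pos hlogz 2), one_mul, pow_two]
      exact mul_le_mul_of_nonneg_right hlogxy hlogz.le
    calc C₂ * A.size x / Real.log x ^ 3 = A.size x * (C₂ / Real.log x ^ 3) := by ring
      _ ≤ A.size x * (Real.log (x / y) / Real.log z ^ 2) :=
          mul_le_mul_of_nonneg_left (ha.trans (hb.trans hc)) hAx
      _ = A.size x * Real.log (x / y) / Real.log z ^ 2 := by ring
  have hLS0 : 0 ≤ Real.log x ^ ks'.sum := pow_nonneg (by linarith) _
  calc |sigma2V A ks' a x y z|
      ≤ Real.log x ^ ks'.sum * Real.log (x / y) ^ a *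
          ∑ m ∈ (Ioc 0 ⌊x / y⌋₊).filter (fun m : ℕ => m.Coprime P), (A.restrictDvd m).sifted x P := h1
    _ ≤ Real.log x ^ ks'.sum * Real.log (x / y) ^ a * ((1 + CF) * C₇' * C₈' * A.size x * Real.log (x / y) /
          Real.log z ^ 2 + A.size x * Real.log (x / y) / Real.log z ^ 2) :=
        mul_le_mul_of_nonneg_left (hsumS.trans (add_le_add hT1 hT2)) (mul_nonneg hLS0 (pow_nonneg hlogxy0.le a))
    _ = ((1 + CF) * C₇' * C₈' + 1) * A.size x * Real.log x ^ ks'.sum * Real.log (x / y) ^ (a + 1) /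
          Real.log z ^ 2 := by
        ring


/-! ### [FriedlanderIwaniecPisa1978] Lemma 12 for vectors -/

/-- The truncated lower sum over the divisors `d < y` of `n`, written over `n.divisors`. [folklore] -/
theorem truncLowerV_eq_sum_divisors (ks' : List ℕ) (k : ℕ) (y : ℝ) {n : ℕ} (hn : n ≠ 0) :
    truncLowerV ks' k y n =
      ∑ d ∈ n.divisors.filter (fun d : ℕ => (d : ℝ) < y),
        frakL ks' d * max 0 (Real.log ((n : ℝ) / d)) ^ k := by
  rw [truncLowerV, Finset.sum_filter, Finset.sum_filter,
    Nat.sum_divisorsAntidiagonal (f := fun a b : ℕ =>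
      if ((a : ℕ) : ℝ) < y then frakL ks' a * Real.log b ^ k else 0)]
  refine Finset.sum_congr rfl fun d hd => ?_
  have hdn : d ∣ n := Nat.dvd_of_mem_divisors hd
  have hd0 : d ≠ 0 := fun h => hn (Nat.eq_zero_of_zero_dvd (h ▸ hdn))
  have hcast : ((n / d : ℕ) : ℝ) = (n : ℝ) / d :=
    Nat.cast_div hdn (by exact_mod_cast hd0)
  have hge : 0 ≤ Real.log ((n : ℝ) / d) := by
    refine Real.log_nonneg ?_
    rw [le_div_iff₀ (by exact_mod_cast Nat.pos_of_ne_zero hd0), one_mul]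
    exact_mod_cast Nat.le_of_dvd (Nat.pos_of_ne_zero hn) hdn
  simp only [hcast, max_eq_right hge]

/-- **`Σ₁` over the divisor first** ([FriedlanderIwaniecPisa1978] p. 738, last display, without
the binomial expansion): `Σ₁ = ∑_{d < y, (d, P(z)) = 1} μ(d) ∑_{n ≤ x, (n,P(z))=1, d ∣ n} a_n φ_d(n)`
(for `d ∣ n` with `(n, P(z)) = 1`, also `(d, P(z)) = 1`, and `φ_d(n) = (log n/d)^k`).
[cite: FriedlanderIwaniecPisa1978, Lemma 12 (proof, p. 738)] -/
theorem sigma1V_eq_sum_frakL_mul (A : SieveSequence) (ks' : List ℕ) (k : ℕ) (x y z : ℝ) :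
    sigma1V A ks' k x y z =
      ∑ d ∈ (Ico 1 ⌈y⌉₊).filter (fun d : ℕ => d.Coprime (primesProdBelow z)),
        frakL ks' d * ∑ n ∈ (Ioc 0 ⌊x⌋₊).filter
            (fun n : ℕ => n.Coprime (primesProdBelow z) ∧ d ∣ n),
          A.a n * max 0 (Real.log ((n : ℝ) / d)) ^ k := by
  set P := primesProdBelow z with hP
  set N := ⌊x⌋₊ with hN
  set S := (Ioc 0 N).filter (fun n : ℕ => n.Coprime P) with hS
  -- Step 1: over divisors
  have h1 : sigma1V A ks' k x y z = ∑ n ∈ S, ∑ d ∈ n.divisors.filter (fun d : ℕ => (d : ℝ) < y),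
      A.a n * (frakL ks' d * max 0 (Real.log ((n : ℝ) / d)) ^ k) := by
    rw [sigma1V, ← hP, ← hN, ← hS]
    refine Finset.sum_congr rfl fun n hn => ?_
    have hn0 : n ≠ 0 := (Finset.mem_Ioc.mp (Finset.mem_filter.mp hn).1).1.ne'
    rw [truncLowerV_eq_sum_divisors ks' k y hn0, mul_comm, Finset.mul_sum]
  -- Step 2: interchange
  have h2 : ∑ n ∈ S, ∑ d ∈ n.divisors.filter (fun d : ℕ => (d : ℝ) < y),
      A.a n * (frakL ks' d * max 0 (Real.log ((n : ℝ) / d)) ^ k) =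
      ∑ d ∈ Ico 1 ⌈y⌉₊, ∑ n ∈ S.filter (fun n : ℕ => d ∣ n),
        A.a n * (frakL ks' d * max 0 (Real.log ((n : ℝ) / d)) ^ k) := by
    refine Finset.sum_comm' fun n d => ?_
    simp only [Finset.mem_filter, Nat.mem_divisors, Finset.mem_Ico, hS, Finset.mem_Ioc]
    constructor
    · rintro ⟨⟨⟨hn0, hnN⟩, hnP⟩, ⟨hdn, -⟩, hdy⟩
      exact ⟨⟨⟨⟨hn0, hnN⟩, hnP⟩, hdn⟩, Nat.pos_of_dvd_of_pos hdn hn0, Nat.lt_ceil.mpr hdy⟩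
    · rintro ⟨⟨⟨⟨hn0, hnN⟩, hnP⟩, hdn⟩, hd1, hdy⟩
      exact ⟨⟨⟨hn0, hnN⟩, hnP⟩, ⟨hdn, hn0.ne'⟩, Nat.lt_ceil.mp hdy⟩
  rw [h1, h2]
  -- Step 3: factor `μ(d)` and restrict to `(d, P) = 1`
  have h3 : ∀ d : ℕ, ∑ n ∈ S.filter (fun n : ℕ => d ∣ n),
      A.a n * (frakL ks' d * max 0 (Real.log ((n : ℝ) / d)) ^ k) =
      frakL ks' d * ∑ n ∈ (Ioc 0 N).filter (fun n : ℕ => n.Coprime P ∧ d ∣ n),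
        A.a n * max 0 (Real.log ((n : ℝ) / d)) ^ k := by
    intro d
    rw [hS, Finset.filter_filter, Finset.mul_sum]
    exact Finset.sum_congr rfl fun n _ => by ring
  simp_rw [h3]
  symm
  refine Finset.sum_subset (Finset.filter_subset _ _) fun d hd hdnot => ?_
  have hdc : ¬ d.Coprime P := fun h => hdnot (Finset.mem_filter.mpr ⟨hd, h⟩)
  rw [Finset.sum_eq_zero fun n hn => ?_, mul_zero]
  obtain ⟨-, hc, hdn⟩ := Finset.mem_filter.mp hn
  exact absurd (Nat.Coprime.coprime_dvd_left hdn hc) hdc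

/-- **[FriedlanderIwaniecPisa1978] Lemma 12 for vectors** (p. 738: "Let `ε > 0`. If `s ≥ 2`, `z ≥ 2` and
`z^s y ≤ x^{1−ε}`, then `Σ₁ = H A(x) F + O{(e^{−s} + β(x) + c(ε)/log x + z^{−η} log x) A(x)(log x)^{|k|−1}
(log x/log z)²}`, `F = ∏_{p∣P(z)}(1 − 1/p) ∑_{d<y,(d,P(z))=1} 𝔏_(k')(d) d⁻¹ (log x/d)^a`"): the tree's
scalar proof (`FI1978_lemma12_of_fundamentalLemma`: the fundamental lemma for the weighted subsequences,
"partial summation (twice)", (A₂), Lemmata 7, 8, 9) with `μ(d)` replaced by `𝔏_(k')(d)` and `|μ| ≤ 1` by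
Lemma 1 (iii), `|𝔏_(k')(d)| ≤ (log x)^{|k'|}` for `d < y ≤ x`; here `a = j + 2`, and the three error
terms of the scalar shape are multiplied by `(log x)^{|k'|}`, i.e. carry `(log x)^{|k|−1}`, `(log x)^{|k|−2}`,
`(log x)^{|k|}`. [cite: FriedlanderIwaniecPisa1978, Lemma 12] -/
theorem lemma12V (A : SieveSequence) (H : ℝ) (hA : A.IsBombieriSequence) (hH : A.HasDensityConstant H)
    (ks' : List ℕ) (j : ℕ) :
    ∃ η : ℝ, 0 < η ∧ ∃ C : ℝ, ∀ ε : ℝ, 0 < ε → ∀ s : ℝ, 2 ≤ s → ∀ᶠ x : ℝ in atTop, ∀ y z : ℝ,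
      2 ≤ z → 1 ≤ y → z ^ s * y ≤ x ^ (1 - ε) →
        |sigma1V A ks' (j + 2) x y z - H * A.size x * mainTermFV ks' (j + 2) x y z| ≤
          C * (Real.exp (-s) * A.size x * Real.log x ^ (j + 1 + ks'.sum) +
                (∫ t in (1 : ℝ)..x, A.size t / t) * Real.log x ^ (j + ks'.sum) +
                z ^ (-η) * A.size x * Real.log x ^ (j + 2 + ks'.sum)) *
            (Real.log x / Real.log z) ^ 2 := by
  have hFL := SieveSequence.fundamental_lemma_uniform_holds
  have hsize := hA.1
  have hA0 : ∀ x, 0 ≤ A.size x := SieveSequence.size_nonneg_of_size_eq hsize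
  have hAsum : ∀ x : ℝ, ∑ n ∈ Ioc 0 ⌊x⌋₊, A.a n = A.size x := fun x => by
    rw [hsize x, SieveSequence.congrSum, Finset.filter_true_of_mem (fun n _ => one_dvd n)]
  rcases density_nonneg_or_size_eq_zero A hA with hg | hzero
  swap
  · -- degenerate case: all `a_n` vanish
    refine ⟨1, one_pos, 0, fun ε hε s hs => Filter.Eventually.of_forall fun x y z _ _ _ => ?_⟩
    have ha : ∀ n ∈ Ioc 0 ⌊x⌋₊, A.a n = 0 :=
      (Finset.sum_eq_zero_iff_of_nonneg fun n _ => A.a_nonneg n).mp ((hAsum x).trans (hzero x))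
    have hs1 : sigma1V A ks' (j + 2) x y z = 0 := by
      rw [sigma1V]
      exact Finset.sum_eq_zero fun n hn => by rw [ha n (Finset.mem_filter.mp hn).1, mul_zero]
    rw [hs1, hzero x]
    simp
  -- the constants
  obtain ⟨K, hK⟩ := hasSieveDimension A hA hg
  obtain ⟨CF, hCF0, hFL'⟩ := hFL 1 K
  obtain ⟨H₇, hH₇0, hH₇, η₇, hη₇, C₇, h7⟩ := FI1978_lemma7_rat A hA
  have hHH : H = H₇ := tendsto_nhds_unique hH hH₇
  subst hHH
  obtain ⟨C₈, h8⟩ := FI1978_lemma8_rat A hA.2.1 hA.2.2.2.2.2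
  obtain ⟨η, hη0, C₉, h9⟩ := FI1978_lemma9_rat A H hA hH
  set C₇' := max C₇ 0 with hC₇'
  set C₈' := max C₈ 0 with hC₈'
  set C₉' := max C₉ 0 with hC₉'
  have hC₇'0 : 0 ≤ C₇' := le_max_right _ _
  have hC₈'0 : 0 ≤ C₈' := le_max_right _ _
  have hC₉'0 : 0 ≤ C₉' := le_max_right _ _
  refine ⟨η, hη0, CF * C₇' * C₈' + 1 + (j + 2) * C₇' * C₈' + C₉', fun ε hε s hs => ?_⟩
  -- (A₂) with this `ε` and `B = k + 1`
  obtain ⟨C₂, hC₂⟩ := hA.2.2.1 ε hε ((j + 3 : ℕ) : ℝ) (by positivity)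
  filter_upwards [hC₂, eventually_ge_atTop (1 : ℝ),
    Real.tendsto_log_atTop.eventually_ge_atTop (max 1 (2 * C₂ * Real.exp s))]
    with x hx2 hx1 hxlog y z hz hy1 hlev
  -- the parameters
  have hx0 : 0 < x := by linarith
  have hlogx1 : 1 ≤ Real.log x := (le_max_left _ _).trans hxlog
  have hC₂log : 2 * C₂ * Real.exp s ≤ Real.log x := (le_max_right _ _).trans hxlog
  have hz0 : 0 < z := by linarith
  have hz1 : 1 < z := by linarith
  have hy0 : 0 < y := by linarith
  have hzs : z ≤ z ^ s := by
    calc z = z ^ (1 : ℝ) := (Real.rpow_one z).symm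
      _ ≤ z ^ s := Real.rpow_le_rpow_of_exponent_le hz1.le (by linarith)
  have hzs0 : 0 < z ^ s := Real.rpow_pos_of_pos hz0 s
  have hx1ε : x ^ (1 - ε) ≤ x := by
    calc x ^ (1 - ε) ≤ x ^ (1 : ℝ) := Real.rpow_le_rpow_of_exponent_le hx1 (by linarith)
      _ = x := Real.rpow_one x
  have hyx : y ≤ x := by
    have h1 : y ≤ z ^ s * y := le_mul_of_one_le_left hy0.le (hz1.le.trans hzs)
    linarith
  have hzx : z ≤ x := by
    have h1 : z ^ s ≤ z ^ s * y := le_mul_of_one_le_right hzs0.le hy1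
    linarith
  have hlogz : 0 < Real.log z := Real.log_pos hz1
  have hlogzx : Real.log z ≤ Real.log x := Real.log_le_log hz0 hzx
  have hlx0 : 0 < Real.log x := by linarith
  set N := ⌊x⌋₊ with hN
  have hNx : (N : ℝ) ≤ x := Nat.floor_le hx0.le
  set P := primesProdBelow z with hP
  set V := A.densityProduct P with hV
  set P₁ := ∏ p ∈ Nat.primesBelow ⌈z⌉₊, (1 - (p : ℝ)⁻¹) with hP₁
  set L := Real.log x with hL
  set Ax := A.size x with hAx
  have hAx0 : 0 ≤ Ax := hA0 x
  have hV0 : 0 ≤ V := by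
    rw [hV, densityProduct_primesProdBelow]
    exact Finset.prod_nonneg fun p hp =>
      (sub_pos.mpr (hA.2.1.2 p (Nat.prime_of_mem_primesBelow hp).one_lt)).le
  have hVle : V ≤ C₇' / Real.log z :=
    (h7 z hz).2.trans (div_le_div_of_nonneg_right (le_max_left _ _) hlogz.le)
  -- the auxiliary height `X₁ = max y z ≤ x` for Lemmata 8, 9
  set X₁ := max y z with hX₁
  have hzX₁ : z ≤ X₁ := le_max_right _ _
  have hX₁x : X₁ ≤ x := max_le hyx hzx
  have hlogX₁ : Real.log X₁ ≤ L := Real.log_le_log (hz0.trans_le hzX₁) hX₁x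
  set M := (Ico 1 ⌈y⌉₊).filter (fun d : ℕ => d.Coprime P) with hM
  have hmemM : ∀ {d : ℕ}, d ∈ M → (1 ≤ d ∧ (d : ℝ) < y) ∧ d.Coprime P := by
    intro d hd
    obtain ⟨hd', hdP⟩ := Finset.mem_filter.mp hd
    obtain ⟨hd1, hdy⟩ := Finset.mem_Ico.mp hd'
    exact ⟨⟨hd1, Nat.lt_ceil.mp hdy⟩, hdP⟩
  have hMsub : M ⊆ (Ioc 0 ⌊X₁⌋₊).filter (fun d : ℕ => d.Coprime P) := by
    intro d hd
    obtain ⟨⟨hd1, hdy⟩, hdP⟩ := hmemM hd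
    refine Finset.mem_filter.mpr ⟨Finset.mem_Ioc.mpr ⟨hd1, Nat.le_floor ?_⟩, hdP⟩
    exact hdy.le.trans (le_max_left _ _)
  -- Lemma 8 and Lemma 9 over `M`
  have hG : ∑ d ∈ M, |A.density d| ≤ C₈' * L / Real.log z := by
    refine (Finset.sum_le_sum_of_subset_of_nonneg hMsub fun _ _ _ => abs_nonneg _).trans ?_
    refine (h8 X₁ z hz hzX₁).trans ?_
    rw [div_le_div_iff_of_pos_right hlogz]
    exact mul_le_mul (le_max_left _ _) hlogX₁ (Real.log_nonneg (hz1.le.trans hzX₁)) hC₈'0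
  have hS9 : ∑ d ∈ M, |A.density d * V - H * P₁ / d| ≤ C₉' * z ^ (-η) * L / Real.log z := by
    refine (Finset.sum_le_sum_of_subset_of_nonneg hMsub fun _ _ _ => abs_nonneg _).trans ?_
    refine (h9 X₁ z hz hzX₁).trans ?_
    rw [div_le_div_iff_of_pos_right hlogz]
    have hzη : 0 ≤ z ^ (-η) := Real.rpow_nonneg hz0.le _
    exact mul_le_mul (mul_le_mul_of_nonneg_right (le_max_left _ _) hzη) hlogX₁
      (Real.log_nonneg (hz1.le.trans hzX₁)) (mul_nonneg hC₉'0 hzη)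
  -- the weights `φ_d`, the sums `T_d`, `W_d`, and `β`
  set w : ℕ → ℕ → ℝ := fun d n => max 0 (Real.log ((n : ℝ) / d)) ^ (j + 2) with hw
  set T : ℕ → ℝ := fun d => ∑ n ∈ Ioc 0 N, A.a n * w d n with hT
  set W : ℕ → ℝ := fun d =>
    ∑ n ∈ (Ioc 0 N).filter (fun n : ℕ => n.Coprime P ∧ d ∣ n), A.a n * w d n with hW
  set I := ∑ n ∈ Ioc 0 N, A.a n * (L - Real.log n) with hI
  have hIeq : ∫ t in (1 : ℝ)..x, A.size t / t = I := integral_size_div_eq A hsize hx1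
  have hI0 : 0 ≤ I := Finset.sum_nonneg fun n hn => by
    have hn := Finset.mem_Ioc.mp hn
    refine mul_nonneg (A.a_nonneg n) (sub_nonneg.mpr (Real.log_le_log ?_ ?_))
    · exact_mod_cast hn.1
    · exact (Nat.cast_le.mpr hn.2).trans hNx
  have hwprops : ∀ {d : ℕ}, 1 ≤ d → (∀ n, 0 ≤ w d n) ∧ Monotone (w d) ∧
      ∀ n : ℕ, d ∣ n → 1 ≤ n → w d n = Real.log ((n : ℝ) / d) ^ (j + 2) :=
    fun hd => logWeight_props (j + 2) hd fun n => rfl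
  have hwN : ∀ {d : ℕ}, 1 ≤ d → w d N ≤ L ^ (j + 2) := by
    intro d hd
    have hd0 : (0 : ℝ) < d := by exact_mod_cast hd
    refine pow_le_pow_left₀ (le_max_left _ _) (max_le hlx0.le ?_) _
    rcases Nat.eq_zero_or_pos N with hN0 | hNpos
    · rw [hN0, Nat.cast_zero, zero_div, Real.log_zero]
      exact hlx0.le
    · calc Real.log ((N : ℝ) / d) ≤ Real.log N :=
            Real.log_le_log (div_pos (by exact_mod_cast hNpos) hd0)
              (div_le_self (Nat.cast_nonneg N) (by exact_mod_cast hd))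
        _ ≤ L := Real.log_le_log (by exact_mod_cast hNpos) hNx
  -- `T_d` against `A(x) (log x/d)^k`
  have hTd : ∀ {d : ℕ}, d ∈ M →
      0 ≤ Ax * Real.log (x / d) ^ (j + 2) - T d ∧
        Ax * Real.log (x / d) ^ (j + 2) - T d ≤ (j + 2 : ℕ) * L ^ (j + 1) * I ∧
        T d ≤ Ax * L ^ (j + 2) := by
    intro d hd
    obtain ⟨⟨hd1, hdy⟩, -⟩ := hmemM hd
    have hdx : (d : ℝ) ≤ x := hdy.le.trans hyx
    have h := size_mul_pow_log_sub_weightedSum_bounds A (k := j + 2) hd1 hdx (w := w d)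
      fun n => rfl
    rw [hAsum x, show j + 2 - 1 = j + 1 from by omega] at h
    refine ⟨h.1, h.2, ?_⟩
    have hd0 : (0 : ℝ) < d := by exact_mod_cast hd1
    have hlxd : Real.log (x / d) ≤ L := by
      rw [Real.log_div hx0.ne' hd0.ne']
      linarith [Real.log_nonneg (show (1 : ℝ) ≤ d by exact_mod_cast hd1)]
    have hlxd0 : 0 ≤ Real.log (x / d) := Real.log_nonneg ((one_le_div hd0).mpr hdx)
    calc T d ≤ Ax * Real.log (x / d) ^ (j + 2) := by linarith [h.1]
      _ ≤ Ax * L ^ (j + 2) := mul_le_mul_of_nonneg_left (pow_le_pow_left₀ hlxd0 hlxd _) hAx0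
  -- the selection `m_q ≤ N` maximising `|R(m; q)|`, and (A₂)
  have hne : (Finset.range (N + 1)).Nonempty := ⟨0, by simp⟩
  choose msel hmsel using fun q : ℕ =>
    Finset.exists_max_image (Finset.range (N + 1)) (fun m : ℕ => |A.remainder q (m : ℝ)|) hne
  set Rstar : ℕ → ℝ := fun q => |A.remainder q (msel q : ℝ)| with hRstar
  have hRstar0 : ∀ q, 0 ≤ Rstar q := fun q => abs_nonneg _
  have hRle : ∀ q m : ℕ, m ≤ N → |A.remainder q (m : ℝ)| ≤ Rstar q := fun q m hm =>
    (hmsel q).2 m (Finset.mem_range.mpr (Nat.lt_succ_of_le hm))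
  have hA2 : ∑ q ∈ Ico 1 ⌈x ^ (1 - ε)⌉₊, Rstar q ≤ C₂ * Ax / L ^ (j + 3) := by
    have h := hx2 (fun q => (msel q : ℝ)) fun q =>
      (Nat.cast_le.mpr (Nat.lt_succ_iff.mp (Finset.mem_range.mp (hmsel q).1))).trans hNx
    rwa [Real.rpow_natCast] at h
  -- Step 1: `Σ₁` over `d` first
  have hSig : sigma1V A ks' (j + 2) x y z = ∑ d ∈ M, frakL ks' d * W d := by
    rw [sigma1V_eq_sum_frakL_mul]
  -- Step 2: the sieve bound for each `d ∈ M`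
  have hWd : ∀ {d : ℕ}, d ∈ M → |W d - A.density d * T d * V| ≤
      CF * Real.exp (-s) * V * Ax * L ^ (j + 2) * |A.density d| +
        2 * L ^ (j + 2) * ∑ ν ∈ P.divisors.filter (fun ν : ℕ => (ν : ℝ) ≤ z ^ s),
          Rstar (d * ν) := by
    intro d hd
    obtain ⟨⟨hd1, hdy⟩, hdP⟩ := hmemM hd
    have hgd : 0 ≤ A.density d := hg d hd1
    obtain ⟨hw0, hwmono, -⟩ := hwprops hd1
    have h := weighted_sifted_sub_le hFL' A hK hw0 hgd hdP x (z ^ s) hz hzs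
    have hexp : Real.exp (-(Real.log (z ^ s) / Real.log z)) = Real.exp (-s) := by
      rw [Real.log_rpow hz0, mul_div_assoc, div_self hlogz.ne', mul_one]
    rw [hexp] at h
    -- the remainders
    have hrem : ∀ ν ∈ P.divisors.filter (fun ν : ℕ => (ν : ℝ) ≤ z ^ s),
        |(∑ n ∈ (Ioc 0 N).filter (fun n : ℕ => d * ν ∣ n), A.a n * w d n) -
            A.density (d * ν) * ∑ n ∈ Ioc 0 N, A.a n * w d n| ≤
          2 * L ^ (j + 2) * Rstar (d * ν) := by
      intro ν hν
      refine (abs_weighted_congrSum_sub_le A hsize hw0 hwmono (d * ν) N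
        (fun m hm => hRle (d * ν) m hm)).trans ?_
      calc 2 * Rstar (d * ν) * w d N ≤ 2 * Rstar (d * ν) * L ^ (j + 2) :=
            mul_le_mul_of_nonneg_left (hwN hd1) (mul_nonneg zero_le_two (hRstar0 _))
        _ = 2 * L ^ (j + 2) * Rstar (d * ν) := by ring
    have hmain : CF * (A.density d * T d) * V * Real.exp (-s) ≤
        CF * Real.exp (-s) * V * Ax * L ^ (j + 2) * |A.density d| := by
      rw [abs_of_nonneg hgd]
      have hT3 := (hTd hd).2.2
      calc CF * (A.density d * T d) * V * Real.exp (-s)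
          = (CF * Real.exp (-s) * V * A.density d) * T d := by ring
        _ ≤ (CF * Real.exp (-s) * V * A.density d) * (Ax * L ^ (j + 2)) :=
            mul_le_mul_of_nonneg_left hT3 (mul_nonneg (mul_nonneg (mul_nonneg hCF0.le
              (Real.exp_pos _).le) hV0) hgd)
        _ = CF * Real.exp (-s) * V * Ax * L ^ (j + 2) * A.density d := by ring
    calc |W d - A.density d * T d * V|
        ≤ CF * (A.density d * T d) * V * Real.exp (-s) +
            ∑ ν ∈ P.divisors.filter (fun ν : ℕ => (ν : ℝ) ≤ z ^ s),
              |(∑ n ∈ (Ioc 0 N).filter (fun n : ℕ => d * ν ∣ n), A.a n * w d n) -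
                  A.density (d * ν) * ∑ n ∈ Ioc 0 N, A.a n * w d n| := h
      _ ≤ CF * Real.exp (-s) * V * Ax * L ^ (j + 2) * |A.density d| +
            ∑ ν ∈ P.divisors.filter (fun ν : ℕ => (ν : ℝ) ≤ z ^ s),
              2 * L ^ (j + 2) * Rstar (d * ν) := add_le_add hmain (Finset.sum_le_sum hrem)
      _ = _ := by rw [Finset.mul_sum]
  -- Step 3: the term-by-term bound for `Σ₁ − H A(x) F`
  set LS := L ^ ks'.sum with hLS
  have hLS0 : 0 ≤ LS := pow_nonneg hlx0.le _
  have hterm : ∀ d ∈ M,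
      |frakL ks' d * W d - H * Ax * (P₁ * (frakL ks' d / d * Real.log (x / d) ^ (j + 2)))| ≤
        LS * (CF * Real.exp (-s) * V * Ax * L ^ (j + 2) * |A.density d| +
          2 * L ^ (j + 2) * ∑ ν ∈ P.divisors.filter (fun ν : ℕ => (ν : ℝ) ≤ z ^ s),
            Rstar (d * ν) +
          (j + 2 : ℕ) * L ^ (j + 1) * I * V * |A.density d| +
          Ax * L ^ (j + 2) * |A.density d * V - H * P₁ / d|) := by
    intro d hd
    obtain ⟨⟨hd1, hdy⟩, hdP⟩ := hmemM hd
    have hgd : 0 ≤ A.density d := hg d hd1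
    have hd0 : (0 : ℝ) < d := by exact_mod_cast hd1
    have hdx : (d : ℝ) ≤ x := hdy.le.trans hyx
    have hlxd : Real.log (x / d) ≤ L := by
      rw [Real.log_div hx0.ne' hd0.ne']
      linarith [Real.log_nonneg (show (1 : ℝ) ≤ d by exact_mod_cast hd1)]
    have hlxd0 : 0 ≤ Real.log (x / d) := Real.log_nonneg ((one_le_div hd0).mpr hdx)
    obtain ⟨hT1, hT2, -⟩ := hTd hd
    have hμ : |frakL ks' d| ≤ LS := abs_frakL_le_log ks' hd1 hdx
    have hid : frakL ks' d * W d - H * Ax * (P₁ * (frakL ks' d / d * Real.log (x / d) ^ (j + 2))) =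
        frakL ks' d * ((W d - A.density d * T d * V) +
          A.density d * V * (T d - Ax * Real.log (x / d) ^ (j + 2)) +
          Ax * Real.log (x / d) ^ (j + 2) * (A.density d * V - H * P₁ / d)) := by ring
    rw [hid, abs_mul]
    refine (mul_le_mul hμ le_rfl (abs_nonneg _) hLS0).trans (mul_le_mul_of_nonneg_left ?_ hLS0)
    refine (abs_add_three _ _ _).trans ?_
    have h2 : |A.density d * V * (T d - Ax * Real.log (x / d) ^ (j + 2))| ≤
        (j + 2 : ℕ) * L ^ (j + 1) * I * V * |A.density d| := by
      rw [abs_of_nonneg hgd, show A.density d * V * (T d - Ax * Real.log (x / d) ^ (j + 2)) =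
        -(A.density d * V * (Ax * Real.log (x / d) ^ (j + 2) - T d)) by ring, abs_neg,
        abs_of_nonneg (mul_nonneg (mul_nonneg hgd hV0) hT1)]
      calc A.density d * V * (Ax * Real.log (x / d) ^ (j + 2) - T d)
          ≤ A.density d * V * ((j + 2 : ℕ) * L ^ (j + 1) * I) :=
            mul_le_mul_of_nonneg_left hT2 (mul_nonneg hgd hV0)
        _ = (j + 2 : ℕ) * L ^ (j + 1) * I * V * A.density d := by ring
    have h3 : |Ax * Real.log (x / d) ^ (j + 2) * (A.density d * V - H * P₁ / d)| ≤
        Ax * L ^ (j + 2) * |A.density d * V - H * P₁ / d| := by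
      rw [abs_mul, abs_of_nonneg (mul_nonneg hAx0 (pow_nonneg hlxd0 _))]
      exact mul_le_mul_of_nonneg_right
        (mul_le_mul_of_nonneg_left (pow_le_pow_left₀ hlxd0 hlxd _) hAx0) (abs_nonneg _)
    linarith [hWd hd, h2, h3]
  -- Step 4: summing over `d ∈ M`
  have hF : H * Ax * mainTermFV ks' (j + 2) x y z =
      ∑ d ∈ M, H * Ax * (P₁ * (frakL ks' d / d * Real.log (x / d) ^ (j + 2))) := by
    rw [mainTermFV, ← hP₁, ← hP, ← hM, Finset.mul_sum, Finset.mul_sum]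
  have hRR : ∑ d ∈ M, ∑ ν ∈ P.divisors.filter (fun ν : ℕ => (ν : ℝ) ≤ z ^ s), Rstar (d * ν) ≤
      C₂ * Ax / L ^ (j + 3) := by
    have hM' : ∀ m ∈ M, m ≠ 0 ∧ m.Coprime P := fun m hm =>
      ⟨by have := (hmemM hm).1.1; omega, (hmemM hm).2⟩
    have hL' : ∀ m ∈ M, (m : ℝ) * z ^ s < x ^ (1 - ε) := by
      intro m hm
      have hmy := (hmemM hm).1.2
      calc (m : ℝ) * z ^ s < y * z ^ s := mul_lt_mul_of_pos_right hmy hzs0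
        _ = z ^ s * y := mul_comm _ _
        _ ≤ x ^ (1 - ε) := hlev
    exact (sum_coprime_sum_divisors_le (primesProdBelow_ne_zero z) Rstar hRstar0 M hM' (z ^ s)
      (x ^ (1 - ε)) hL').trans hA2
  have hsum : |sigma1V A ks' (j + 2) x y z - H * Ax * mainTermFV ks' (j + 2) x y z| ≤
      LS * (CF * Real.exp (-s) * V * Ax * L ^ (j + 2) * (C₈' * L / Real.log z) +
        2 * L ^ (j + 2) * (C₂ * Ax / L ^ (j + 3)) +
        (j + 2 : ℕ) * L ^ (j + 1) * I * V * (C₈' * L / Real.log z) +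
        Ax * L ^ (j + 2) * (C₉' * z ^ (-η) * L / Real.log z)) := by
    rw [hSig, hF, ← Finset.sum_sub_distrib]
    refine (Finset.abs_sum_le_sum_abs _ _).trans ?_
    refine (Finset.sum_le_sum hterm).trans ?_
    rw [← Finset.mul_sum]
    refine mul_le_mul_of_nonneg_left ?_ hLS0
    rw [Finset.sum_add_distrib, Finset.sum_add_distrib, Finset.sum_add_distrib,
      ← Finset.mul_sum, ← Finset.mul_sum, ← Finset.mul_sum, ← Finset.mul_sum]
    have hg_sum : ∑ d ∈ M, |A.density d| ≤ C₈' * L / Real.log z := hG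
    have hc1 : 0 ≤ CF * Real.exp (-s) * V * Ax * L ^ (j + 2) :=
      mul_nonneg (mul_nonneg (mul_nonneg (mul_nonneg hCF0.le (Real.exp_pos _).le) hV0) hAx0)
        (pow_nonneg hlx0.le _)
    have hc2 : 0 ≤ 2 * L ^ (j + 2) := mul_nonneg zero_le_two (pow_nonneg hlx0.le _)
    have hc3 : 0 ≤ (j + 2 : ℕ) * L ^ (j + 1) * I * V :=
      mul_nonneg (mul_nonneg (mul_nonneg (Nat.cast_nonneg _) (pow_nonneg hlx0.le _)) hI0) hV0
    have hc4 : 0 ≤ Ax * L ^ (j + 2) := mul_nonneg hAx0 (pow_nonneg hlx0.le _)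
    gcongr
  -- Step 5: the final shape
  have hQ1 : 1 ≤ L / Real.log z := by rwa [le_div_iff₀ hlogz, one_mul]
  have hQ : L / Real.log z ≤ (L / Real.log z) ^ 2 := le_self_pow₀ hQ1 two_ne_zero
  have hLj1 : 1 ≤ L ^ (j + 1) := one_le_pow₀ hlogx1
  have hes0 : 0 < Real.exp (-s) := Real.exp_pos _
  have hzη : 0 ≤ z ^ (-η) := Real.rpow_nonneg hz0.le _
  -- term 1
  have ht1 : CF * Real.exp (-s) * V * Ax * L ^ (j + 2) * (C₈' * L / Real.log z) ≤
      CF * C₇' * C₈' * (Real.exp (-s) * Ax * L ^ (j + 1)) * (L / Real.log z) ^ 2 := by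
    have hnn : 0 ≤ CF * Real.exp (-s) * Ax * L ^ (j + 2) * (C₈' * L / Real.log z) :=
      mul_nonneg (mul_nonneg (mul_nonneg (mul_nonneg hCF0.le hes0.le) hAx0)
        (pow_nonneg hlx0.le _)) (div_nonneg (mul_nonneg hC₈'0 hlx0.le) hlogz.le)
    calc CF * Real.exp (-s) * V * Ax * L ^ (j + 2) * (C₈' * L / Real.log z)
        = CF * Real.exp (-s) * Ax * L ^ (j + 2) * (C₈' * L / Real.log z) * V := by ring
      _ ≤ CF * Real.exp (-s) * Ax * L ^ (j + 2) * (C₈' * L / Real.log z) *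
            (C₇' / Real.log z) := mul_le_mul_of_nonneg_left hVle hnn
      _ = CF * C₇' * C₈' * (Real.exp (-s) * Ax * L ^ (j + 1)) * (L / Real.log z) ^ 2 := by
          field_simp
          ring
  -- term 2
  have ht2 : 2 * L ^ (j + 2) * (C₂ * Ax / L ^ (j + 3)) ≤
      1 * (Real.exp (-s) * Ax * L ^ (j + 1)) * (L / Real.log z) ^ 2 := by
    have h2C : 2 * C₂ ≤ L * Real.exp (-s) := by
      have h1 : 2 * C₂ * Real.exp s * Real.exp (-s) ≤ L * Real.exp (-s) :=
        mul_le_mul_of_nonneg_right hC₂log hes0.le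
      rwa [mul_assoc, ← Real.exp_add, add_neg_cancel, Real.exp_zero, mul_one] at h1
    have hLpow : L ^ (j + 3) = L ^ (j + 2) * L := by ring
    calc 2 * L ^ (j + 2) * (C₂ * Ax / L ^ (j + 3))
        = (2 * C₂) * Ax / L := by
          rw [hLpow]
          field_simp
      _ ≤ (L * Real.exp (-s)) * Ax / L :=
          div_le_div_of_nonneg_right (mul_le_mul_of_nonneg_right h2C hAx0) hlx0.le
      _ = Real.exp (-s) * Ax := by field_simp
      _ ≤ Real.exp (-s) * Ax * L ^ (j + 1) := le_mul_of_one_le_right (mul_nonneg hes0.le hAx0) hLj1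
      _ ≤ Real.exp (-s) * Ax * L ^ (j + 1) * (L / Real.log z) ^ 2 :=
          le_mul_of_one_le_right (mul_nonneg (mul_nonneg hes0.le hAx0) (zero_le_one.trans hLj1))
            (one_le_pow₀ hQ1)
      _ = 1 * (Real.exp (-s) * Ax * L ^ (j + 1)) * (L / Real.log z) ^ 2 := by ring
  -- term 3
  have ht3 : (j + 2 : ℕ) * L ^ (j + 1) * I * V * (C₈' * L / Real.log z) ≤
      (j + 2 : ℕ) * C₇' * C₈' * (I * L ^ j) * (L / Real.log z) ^ 2 := by
    have hnn : 0 ≤ (j + 2 : ℕ) * L ^ (j + 1) * I * (C₈' * L / Real.log z) :=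
      mul_nonneg (mul_nonneg (mul_nonneg (Nat.cast_nonneg _) (pow_nonneg hlx0.le _)) hI0)
        (div_nonneg (mul_nonneg hC₈'0 hlx0.le) hlogz.le)
    calc (j + 2 : ℕ) * L ^ (j + 1) * I * V * (C₈' * L / Real.log z)
        = (j + 2 : ℕ) * L ^ (j + 1) * I * (C₈' * L / Real.log z) * V := by ring
      _ ≤ (j + 2 : ℕ) * L ^ (j + 1) * I * (C₈' * L / Real.log z) * (C₇' / Real.log z) :=
          mul_le_mul_of_nonneg_left hVle hnn
      _ = (j + 2 : ℕ) * C₇' * C₈' * (I * L ^ j) * (L / Real.log z) ^ 2 := by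
          field_simp
          ring
  -- term 4
  have ht4 : Ax * L ^ (j + 2) * (C₉' * z ^ (-η) * L / Real.log z) ≤
      C₉' * (z ^ (-η) * Ax * L ^ (j + 2)) * (L / Real.log z) ^ 2 := by
    calc Ax * L ^ (j + 2) * (C₉' * z ^ (-η) * L / Real.log z)
        = C₉' * (z ^ (-η) * Ax * L ^ (j + 2)) * (L / Real.log z) := by ring
      _ ≤ C₉' * (z ^ (-η) * Ax * L ^ (j + 2)) * (L / Real.log z) ^ 2 :=
          mul_le_mul_of_nonneg_left hQ (mul_nonneg hC₉'0 (mul_nonneg (mul_nonneg hzη hAx0)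
            (pow_nonneg hlx0.le _)))
  -- conclusion (vector case: everything multiplied by `LS = L^{|k'|}`)
  rw [hIeq]
  push_cast at ht3 hsum ⊢
  have hQ0 : 0 ≤ (L / Real.log z) ^ 2 := sq_nonneg _
  have hE₁0 : 0 ≤ Real.exp (-s) * Ax * L ^ (j + 1) :=
    mul_nonneg (mul_nonneg hes0.le hAx0) (pow_nonneg hlx0.le _)
  have hE₂0 : 0 ≤ I * L ^ j := mul_nonneg hI0 (pow_nonneg hlx0.le _)
  have hE₃0 : 0 ≤ z ^ (-η) * Ax * L ^ (j + 2) :=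
    mul_nonneg (mul_nonneg hzη hAx0) (pow_nonneg hlx0.le _)
  have ha0 : 0 ≤ CF * C₇' * C₈' := mul_nonneg (mul_nonneg hCF0.le hC₇'0) hC₈'0
  have hb0 : 0 ≤ ((j : ℝ) + 2) * C₇' * C₈' := mul_nonneg (mul_nonneg (by positivity) hC₇'0) hC₈'0
  have h4 := hsum.trans (mul_le_mul_of_nonneg_left
    (add_le_add (add_le_add (add_le_add ht1 ht2) ht3) ht4) hLS0)
  have hgoal : (CF * C₇' * C₈' + 1 + ((j : ℝ) + 2) * C₇' * C₈' + C₉') *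
      (Real.exp (-s) * Ax * L ^ (j + 1 + ks'.sum) + I * L ^ (j + ks'.sum) +
        z ^ (-η) * Ax * L ^ (j + 2 + ks'.sum)) * (L / Real.log z) ^ 2 =
      LS * ((CF * C₇' * C₈' + 1 + ((j : ℝ) + 2) * C₇' * C₈' + C₉') *
        (Real.exp (-s) * Ax * L ^ (j + 1) + I * L ^ j + z ^ (-η) * Ax * L ^ (j + 2)) *
          (L / Real.log z) ^ 2) := by
    rw [hLS, pow_add, pow_add, pow_add]; ring
  rw [hgoal]
  refine h4.trans (mul_le_mul_of_nonneg_left ?_ hLS0)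
  clear ht1 ht2 ht3 ht4 hsum hterm hWd hF hRR hSig hTd hwN hwprops hA2 hRle hmsel hgoal h4
  generalize (L / Real.log z) ^ 2 = Q at hQ0 ⊢
  generalize Real.exp (-s) * Ax * L ^ (j + 1) = E₁ at hE₁0 ⊢
  generalize I * L ^ j = E₂ at hE₂0 ⊢
  generalize z ^ (-η) * Ax * L ^ (j + 2) = E₃ at hE₃0 ⊢
  generalize CF * C₇' * C₈' = a at ha0 ⊢
  generalize ((j : ℝ) + 2) * C₇' * C₈' = b at hb0 ⊢
  have hid : (a + 1 + b + C₉') * (E₁ + E₂ + E₃) * Q -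
      (a * E₁ * Q + 1 * E₁ * Q + b * E₂ * Q + C₉' * E₃ * Q) =
      Q * (a * (E₂ + E₃) + (E₂ + E₃) + b * (E₁ + E₃) + C₉' * (E₁ + E₂)) := by ring
  have h0 : 0 ≤ Q * (a * (E₂ + E₃) + (E₂ + E₃) + b * (E₁ + E₃) + C₉' * (E₁ + E₂)) :=
    mul_nonneg hQ0 (add_nonneg (add_nonneg (add_nonneg (mul_nonneg ha0 (add_nonneg hE₂0 hE₃0))
      (add_nonneg hE₂0 hE₃0)) (mul_nonneg hb0 (add_nonneg hE₁0 hE₃0)))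
      (mul_nonneg hC₉'0 (add_nonneg hE₁0 hE₂0)))
  linarith only [hid, h0]

/-! ### The three lemmata combined, vector case ([FriedlanderIwaniecPisa1978] pp. 739–740) -/

/-- Arithmetic of the vector `Σ₂`-bound: Lemma 11 for vectors with `log (x/y) = 2v³L`, `log z = v⁴L`,
`a = j + 2`, `m = j + |k'|` gives `|Σ₂| ≤ C 2^{j+3} v^{3j+1} A L^{m+1} ≤ C⁺ 2^{j+3} v · A L^{m+1}` for
`0 < v ≤ 1` (the exponent `3j + 1 = 3(a+1) − 8 ≥ 1` is where `a ≥ 2` enters). [folklore] -/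
theorem sigma2V_arith {T C S L v : ℝ} {m j S' : ℕ} (hS : 0 ≤ S) (hL : 0 < L) (hv0 : 0 < v)
    (hv1 : v ≤ 1) (hm : m = j + S')
    (h : |T| ≤ C * S * L ^ S' * (2 * v ^ 3 * L) ^ (j + 2 + 1) / (v ^ 4 * L) ^ 2) :
    |T| ≤ max C 0 * 2 ^ (j + 3) * v * (S * L ^ (m + 1)) := by
  have hq : L ^ S' * (2 * v ^ 3 * L) ^ (j + 2 + 1) / (v ^ 4 * L) ^ 2 =
      2 ^ (j + 3) * v ^ (3 * j + 1) * L ^ (m + 1) := by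
    rw [div_eq_iff (by positivity), hm]
    ring
  have hvpow : v ^ (3 * j + 1) ≤ v := pow_le_of_le_one hv0.le hv1 (by omega)
  have h0 : 0 ≤ 2 ^ (j + 3) * v ^ (3 * j + 1) * L ^ (m + 1) := by positivity
  calc |T| ≤ C * S * L ^ S' * (2 * v ^ 3 * L) ^ (j + 2 + 1) / (v ^ 4 * L) ^ 2 := h
    _ = C * S * (L ^ S' * (2 * v ^ 3 * L) ^ (j + 2 + 1) / (v ^ 4 * L) ^ 2) := by ring
    _ = C * S * (2 ^ (j + 3) * v ^ (3 * j + 1) * L ^ (m + 1)) := by rw [hq]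
    _ ≤ max C 0 * S * (2 ^ (j + 3) * v ^ (3 * j + 1) * L ^ (m + 1)) := by
        gcongr
        exact le_max_left C 0
    _ = (max C 0 * 2 ^ (j + 3) * (S * L ^ (m + 1))) * v ^ (3 * j + 1) := by ring
    _ ≤ (max C 0 * 2 ^ (j + 3) * (S * L ^ (m + 1))) * v :=
        mul_le_mul_of_nonneg_left hvpow (by positivity)
    _ = max C 0 * 2 ^ (j + 3) * v * (S * L ^ (m + 1)) := by ring

/-- **The three lemmata combined, vector case** ([FriedlanderIwaniecPisa1978] pp. 739–740, up to
`∑_{n ≤ x} a_n Λ_(k)(n) = H A(x) F + O(ε^{1/3} A(x)(log x)^{|k|−1})`): with `u = ε^{−1/3} → ∞`,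
`y = x^{1−2u^{−3}}`, `z = x^{u^{−4}}`, `s = u`, for `(k) = ((k'), j+2)`: for every `ε' > 0`, for all large
`u` and then all large `x`, `|∑_{n ≤ x} a_n Λ_(k)(n) − H A(x) F| ≤ ε' A(x)(log x)^{|k|−1}` (the tree's
`BombieriSieve.core` with Lemma 10 through `Λ_(k) ≤ Λ_{|k|}`, Lemma 11 and Lemma 12 for vectors).
[cite: FriedlanderIwaniecPisa1978, pp. 739-740 (conclusion of proof of Theorem 1)] -/
theorem coreV {A : SieveSequence} {H : ℝ} (hA : A.IsBombieriSequence) (hH : A.HasDensityConstant H)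
    (ks' : List ℕ) (j : ℕ) {ε : ℝ} (hε : 0 < ε) :
    ∀ᶠ u : ℝ in atTop, ∀ᶠ x : ℝ in atTop,
      |(∑ n ∈ Ioc 0 ⌊x⌋₊, lambdaVec ((j + 2) :: ks') n * A.a n) -
          H * A.size x * mainTermFV ks' (j + 2) x (x ^ (1 - 2 * u⁻¹ ^ 3)) (x ^ (u⁻¹ ^ 4))| ≤
        ε * A.size x * Real.log x ^ (j + 1 + ks'.sum) := by
  set m : ℕ := j + ks'.sum with hm
  have hKsum : ((j + 2) :: ks').sum = m + 2 := by rw [List.sum_cons, hm]; ring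
  have e1 : m + 2 - 1 = m + 1 := by omega
  have e2 : m + 2 - 2 = m := by omega
  have ejm : j + 1 + ks'.sum = m + 1 := by rw [hm]; ring
  obtain ⟨C₀, hC₀⟩ := FI1978_lemma10_holds A hA (m + 2) (by omega)
  obtain ⟨C₂, hC₂⟩ := lemma11V A hA ks' (j + 2)
  obtain ⟨η, hη, C₁, hC₁⟩ := lemma12V A H hA hH ks' j
  simp only [e1, e2] at hC₀
  rw [ejm]
  have e3 : j + 1 + ks'.sum = m + 1 := ejm
  have e4 : j + ks'.sum = m := hm.symm
  have e5 : j + 2 + ks'.sum = m + 2 := by rw [hm]; ring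
  simp only [e3, e4, e5] at hC₁
  set D₀ := max C₀ 0 with hD₀
  set D₁ := max C₁ 0 with hD₁
  set D₂ := max C₂ 0 with hD₂
  -- the function `Ψ(u)` bounding `|S − HAF| / (A L^{k−1})` tends to `0`
  have hΨ : Tendsto (fun u : ℝ => (D₀ + 1 + 2 * D₁) * u⁻¹ ^ 4 + D₂ * 2 ^ (j + 3) * u⁻¹ +
      D₁ * (u ^ 8 * Real.exp (-u))) atTop (𝓝 0) := by
    have h1 : Tendsto (fun u : ℝ => u⁻¹) atTop (𝓝 0) := tendsto_inv_atTop_zero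
    have h2 : Tendsto (fun u : ℝ => u⁻¹ ^ 4) atTop (𝓝 0) := by simpa using h1.pow 4
    have h3 := Real.tendsto_pow_mul_exp_neg_atTop_nhds_zero 8
    simpa using ((h2.const_mul (D₀ + 1 + 2 * D₁)).add (h1.const_mul (D₂ * 2 ^ (j + 3)))).add
      (h3.const_mul D₁)
  filter_upwards [(tendsto_order.1 hΨ).2 ε hε, eventually_ge_atTop (2 : ℝ)] with u hu hu2
  -- from now on `u ≥ 2` is fixed; `v = u⁻¹ ≤ 1/2`
  have hu0 : 0 < u := by linarith
  set v : ℝ := u⁻¹ with hv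
  have hv0 : 0 < v := inv_pos.mpr hu0
  have hv1 : v ≤ 1 / 2 := by rw [hv, one_div]; exact (inv_le_inv₀ hu0 two_pos).mpr hu2
  have hvu : v * u = 1 := by rw [hv]; exact inv_mul_cancel₀ hu0.ne'
  -- the three lemmata at this `u`
  have h10' := hC₀ (v ^ 4) (by positivity)
  have h11' := hC₂ (v ^ 3) (by positivity)
  have h12' := hC₁ (v ^ 3) (by positivity) u hu2
  -- (A₄): `∫₁^x A(t) dt/t ≤ v¹² A(x) log x` eventually
  have hI : ∀ᶠ x : ℝ in atTop,
      ∫ t in (1 : ℝ)..x, A.size t / t ≤ v ^ 12 * (A.size x * Real.log x) := by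
    filter_upwards [hA.2.2.2.2.1.1.bound (by positivity : 0 < v ^ 12),
      eventually_ge_atTop (1 : ℝ)] with x hx hx1
    have hA0 : 0 ≤ A.size x := SieveSequence.size_nonneg_of_size_eq hA.size_eq x
    rw [Real.norm_of_nonneg (mul_nonneg hA0 (Real.log_nonneg hx1))] at hx
    exact (le_abs_self _).trans hx
  -- `z^{−η} log x = x^{−η v⁴} log x ≤ v¹²` eventually
  have hzeta : ∀ᶠ x : ℝ in atTop, x ^ (-(η * v ^ 4)) * Real.log x ≤ v ^ 12 := by
    have hlo :=
      (isLittleO_log_rpow_rpow_atTop 1 (by positivity : 0 < η * v ^ 4)).tendsto_div_nhds_zero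
    filter_upwards [(tendsto_order.1 hlo).2 _ (by positivity : 0 < v ^ 12),
      eventually_gt_atTop (0 : ℝ)] with x hx hx0
    rw [Real.rpow_one] at hx
    rw [Real.rpow_neg hx0.le, inv_mul_eq_div]
    exact hx.le
  have hz2 : ∀ᶠ x : ℝ in atTop, 2 ≤ x ^ (v ^ 4) :=
    (tendsto_rpow_atTop (by positivity : 0 < v ^ 4)).eventually_ge_atTop 2
  filter_upwards [h10', h11', h12', hI, hzeta, hz2, eventually_ge_atTop (2 : ℝ)]
    with x h10x h11x h12x hIx hzx hz2x hx2
  -- notation and elementary facts at this `x`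
  have hx0 : 0 < x := by linarith
  have hx1 : 1 < x := by linarith
  obtain ⟨hz14, hzy, hzsy, hyx, hy1, hzsy'⟩ := params hv0 hv1 hvu hx2
  set L := Real.log x with hL
  set S := A.size x with hS
  set y := x ^ (1 - 2 * v ^ 3) with hy
  set z := x ^ (v ^ 4) with hz
  have hL0 : 0 < L := Real.log_pos hx1
  have hS0 : 0 ≤ S := SieveSequence.size_nonneg_of_size_eq hA.size_eq x
  have hy0 : 0 < y := Real.rpow_pos_of_pos hx0 _
  have hlogz : Real.log z = v ^ 4 * L := Real.log_rpow hx0 _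
  have hlogxy : Real.log (x / y) = 2 * v ^ 3 * L := by
    rw [Real.log_div hx0.ne' hy0.ne', hy, Real.log_rpow hx0]; ring
  -- Lemma 10: Σ₀ ≤ (D₀ + 1) v⁴ · S L^{m+1}
  have B0 : sigma0V A ((j + 2) :: ks') x z ≤ (D₀ + 1) * v ^ 4 * (S * L ^ (m + 1)) := by
    have h := h10x z hz2x hz14
    rw [hlogz] at h
    exact sigma0_arith hS0 hL0.le ((sigma0V_le_sigma0 A _ x z).trans (hKsum ▸ h))
  -- Lemma 11: |Σ₂| ≤ D₂ 2^{j+3} v · S L^{m+1}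
  have B2 : |sigma2V A ks' (j + 2) x y z| ≤ D₂ * 2 ^ (j + 3) * v * (S * L ^ (m + 1)) := by
    have h := h11x y z hz2x hzy hzsy hyx
    rw [hlogxy, hlogz] at h
    exact sigma2V_arith hS0 hL0 hv0 (by linarith) hm h
  -- Lemma 12: |Σ₁ − HSF| ≤ D₁ (u⁸ e^{−u} + 2 v⁴) · S L^{m+1}
  have B1 : |sigma1V A ks' (j + 2) x y z - H * S * mainTermFV ks' (j + 2) x y z| ≤
      D₁ * (u ^ 8 * Real.exp (-u) + 2 * v ^ 4) * (S * L ^ (m + 1)) := by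
    have h := h12x y z hz2x hy1 hzsy'
    have hratio : L / Real.log z = u ^ 4 := by
      rw [hlogz, div_eq_iff (by positivity)]
      have : v ^ 4 * u ^ 4 = 1 := by rw [← mul_pow, hvu, one_pow]
      calc L = L * (v ^ 4 * u ^ 4) := by rw [this, mul_one]
        _ = u ^ 4 * (v ^ 4 * L) := by ring
    have hzη : z ^ (-η) = x ^ (-(η * v ^ 4)) := by
      rw [hz, ← Real.rpow_mul hx0.le]; ring_nf
    rw [hratio, hzη] at h
    have hint0 : 0 ≤ ∫ t in (1 : ℝ)..x, A.size t / t :=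
      intervalIntegral.integral_nonneg hx1.le fun t ht =>
        div_nonneg (SieveSequence.size_nonneg_of_size_eq hA.size_eq t) (by linarith [ht.1])
    exact sigma1_arith hS0 hL0.le (Real.exp_pos _).le hint0 (Real.rpow_nonneg hx0.le _) hvu hIx
      hzx h
  -- combine
  have hsplit := sum_eq_sigma0V_add_sigma1V_add_sigma2V A ks' (by omega : 0 < j + 2) x y z
  have h0abs : |sigma0V A ((j + 2) :: ks') x z| = sigma0V A ((j + 2) :: ks') x z :=
    abs_of_nonneg (sigma0V_nonneg A _ x z)
  have hW0 : 0 ≤ S * L ^ (m + 1) := by positivity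
  calc |(∑ n ∈ Ioc 0 ⌊x⌋₊, lambdaVec ((j + 2) :: ks') n * A.a n) -
          H * S * mainTermFV ks' (j + 2) x y z|
      = |sigma0V A ((j + 2) :: ks') x z + (sigma1V A ks' (j + 2) x y z - H * S * mainTermFV ks' (j + 2) x y z) +
          sigma2V A ks' (j + 2) x y z| := by rw [hsplit]; ring_nf
    _ ≤ |sigma0V A ((j + 2) :: ks') x z| + |sigma1V A ks' (j + 2) x y z - H * S * mainTermFV ks' (j + 2) x y z| +
          |sigma2V A ks' (j + 2) x y z| := abs_add_three _ _ _
    _ ≤ (D₀ + 1) * v ^ 4 * (S * L ^ (m + 1)) +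
          D₁ * (u ^ 8 * Real.exp (-u) + 2 * v ^ 4) * (S * L ^ (m + 1)) +
          D₂ * 2 ^ (j + 3) * v * (S * L ^ (m + 1)) := by rw [h0abs]; linarith
    _ = ((D₀ + 1 + 2 * D₁) * v ^ 4 + D₂ * 2 ^ (j + 3) * v + D₁ * (u ^ 8 * Real.exp (-u))) *
          (S * L ^ (m + 1)) := by ring
    _ ≤ ε * (S * L ^ (m + 1)) := mul_le_mul_of_nonneg_right hu.le hW0
    _ = ε * S * L ^ (m + 1) := by ring


/-! ### [FriedlanderIwaniecPisa1978] Lemma 2/3 for vectors (`K = ℚ`): weighted Mertens for `Λ_b` -/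

/-- Dirichlet's rearrangement for a general kernel: `∑_{n ≤ N} ∑_{ef = n} H(e, f) = ∑_{e ≤ N} ∑_{f ≤ N/e} H(e, f)`
(the proof of Mathlib's `ArithmeticFunction.sum_Ioc_mul_eq_sum_sum`, verbatim for a general `H`). [folklore] -/
theorem sum_Ioc_antidiagonal_eq_sum_sum (H : ℕ → ℕ → ℝ) (N : ℕ) :
    ∑ n ∈ Ioc 0 N, ∑ x ∈ n.divisorsAntidiagonal, H x.1 x.2 = ∑ e ∈ Ioc 0 N, ∑ f ∈ Ioc 0 (N / e), H e f := by
  classical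
  trans ∑ n ∈ Ioc 0 N, ∑ x ∈ Ioc 0 N ×ˢ Ioc 0 N with x.1 * x.2 = n, H x.1 x.2
  · refine Finset.sum_congr rfl fun n hn => ?_
    simp only [Finset.mem_Ioc] at hn
    rw [Nat.divisorsAntidiagonal_eq_prod_filter_of_le hn.1.ne' hn.2]
  · trans ∑ x ∈ Ioc 0 N ×ˢ Ioc 0 N with x.1 * x.2 ≤ N, H x.1 x.2
    · simp_rw [Finset.sum_filter]
      rw [Finset.sum_comm]
      exact Finset.sum_congr rfl fun _ _ => (by simp_all)
    · rw [Finset.sum_filter, Finset.sum_product]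
      refine Finset.sum_congr rfl fun n hn => ?_
      simp only [Finset.sum_ite, not_le, Finset.sum_const_zero, add_zero]
      congr
      ext m
      simp only [Finset.mem_filter, Finset.mem_Ioc, and_assoc, and_congr_right_iff] at hn ⊢
      intro _
      constructor
      · rintro ⟨_, h⟩
        exact (Nat.le_div_iff_mul_le hn.1).mpr (by rw [mul_comm]; exact h)
      · intro hm
        exact ⟨le_trans hm (Nat.div_le_self _ _), by
          rw [mul_comm]; exact (Nat.le_div_iff_mul_le hn.1).mp hm⟩

/-- The Beta coefficients `B(b, m) = b! m!/(b+m)!` of the weighted Mertens estimates, and the recursion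
`B(b+1, m) = B(b, m) − B(b, m+1) + B(b, m)/(b+m+1)`. [folklore] -/
theorem betaCoeff_succ (b m : ℕ) :
    ((b + 1).factorial * m.factorial : ℝ) / ((b + 1 + m).factorial : ℝ) =
      (b.factorial * m.factorial : ℝ) / ((b + m).factorial : ℝ) -
        (b.factorial * (m + 1).factorial : ℝ) / ((b + (m + 1)).factorial : ℝ) +
        (b.factorial * m.factorial : ℝ) / ((b + m).factorial : ℝ) / ((b + m : ℕ) + 1) := by
  have h1 : ((b + 1 + m).factorial : ℝ) = ((b + m : ℕ) + 1) * ((b + m).factorial : ℝ) := by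
    rw [show b + 1 + m = (b + m) + 1 by ring, Nat.factorial_succ]; push_cast; ring
  have h2 : ((b + (m + 1)).factorial : ℝ) = ((b + m : ℕ) + 1) * ((b + m).factorial : ℝ) := by
    rw [show b + (m + 1) = (b + m) + 1 by ring, Nat.factorial_succ]; push_cast; ring
  have h3 : ((b + 1).factorial : ℝ) = ((b : ℝ) + 1) * (b.factorial : ℝ) := by
    rw [Nat.factorial_succ]; push_cast; ring
  have h4 : ((m + 1).factorial : ℝ) = ((m : ℝ) + 1) * (m.factorial : ℝ) := by
    rw [Nat.factorial_succ]; push_cast; ring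
  have hf : ((b + m).factorial : ℝ) ≠ 0 := by positivity
  rw [h1, h2, h3, h4]
  push_cast
  field_simp
  ring

/-- **Weighted Mertens estimates for `Λ_b`** ([FriedlanderIwaniecPisa1978] Lemma 2 for `K = ℚ`, in the
form needed for Lemma 3): for `b ≥ 1` and `m ≥ 0` there is `C` with, for all `x ≥ 1`,
`|∑_{d ≤ x} Λ_b(d) d⁻¹ (log x/d)^m − (b! m!/(b+m)!) (log x)^{b+m}| ≤ C (1 + log x)^{b+m−1}`.
Induction on `b` by the recursion `Λ_{b+1} = Λ_b log + Λ * Λ_b`: the `log`-term is `L Φ_b^m − Φ_b^{m+1}`,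
the convolution term is `∑_e Λ(e)/e Φ_b^m(x/e)`, evaluated by the hypothesis at `x/e` and the weighted
Mertens estimate for `Λ` (the tree's `abs_sum_vonMangoldt_div_mul_pow_log_sub_le`,
`abs_sum_vonMangoldt_div_sub_log_le`); no form of the prime number theorem is used.
[cite: FriedlanderIwaniecPisa1978, Lemma 2 (K = Q)] -/
theorem weightedMertens_generalizedVonMangoldt (b : ℕ) (hb : 1 ≤ b) (m : ℕ) :
    ∃ C : ℝ, ∀ x : ℝ, 1 ≤ x →
      |(∑ d ∈ Ioc 0 ⌊x⌋₊, generalizedVonMangoldt b d / d * Real.log (x / d) ^ m) -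
          (b.factorial * m.factorial : ℝ) / ((b + m).factorial : ℝ) * Real.log x ^ (b + m)| ≤
        C * (1 + Real.log x) ^ (b + m - 1) := by
  induction b, hb using Nat.le_induction generalizing m with
  | base =>
    rcases m with _ | j
    · refine ⟨6, fun x hx => ?_⟩
      have h := SelbergSymmetry.abs_sum_vonMangoldt_div_sub_log_le hx
      simp only [pow_zero, mul_one, Nat.factorial_one, Nat.factorial_zero, Nat.cast_one, add_zero,
        div_one, one_mul, pow_one, Nat.sub_self, generalizedVonMangoldt_one]
      exact h
    · refine ⟨6, fun x hx => ?_⟩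
      have h := abs_sum_vonMangoldt_div_mul_pow_log_sub_le hx j
      have hL0 : 0 ≤ Real.log x := Real.log_nonneg hx
      have hcoef : ((Nat.factorial 1 * (j + 1).factorial : ℝ)) / ((1 + (j + 1)).factorial : ℝ) =
          1 / ((j : ℝ) + 2) := by
        rw [show 1 + (j + 1) = (j + 1) + 1 by ring, Nat.factorial_succ (j + 1)]
        push_cast
        have : ((j + 1).factorial : ℝ) ≠ 0 := by positivity
        field_simp
        ring
      rw [generalizedVonMangoldt_one, hcoef, show 1 + (j + 1) = j + 2 by ring,
        show j + 2 - 1 = j + 1 by omega, one_div_mul_eq_div]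
      refine h.trans ?_
      gcongr
      linarith
  | succ b hb ih =>
    -- constants from the hypothesis at `m` and `m + 1`
    obtain ⟨C₁, hC₁⟩ := ih m
    obtain ⟨C₂, hC₂⟩ := ih (m + 1)
    set B : ℝ := (b.factorial * m.factorial : ℝ) / ((b + m).factorial : ℝ) with hB
    set B' : ℝ := (b.factorial * (m + 1).factorial : ℝ) / ((b + (m + 1)).factorial : ℝ) with hB'
    have hB0 : 0 ≤ B := by positivity
    set C₁' := max C₁ 0 with hC₁'
    set C₂' := max C₂ 0 with hC₂'
    refine ⟨C₁' + C₂' + 6 * B + 6 * C₁', fun x hx => ?_⟩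
    have hx0 : 0 < x := by linarith
    set L := Real.log x with hL
    have hL0 : 0 ≤ L := Real.log_nonneg hx
    set N := ⌊x⌋₊ with hN
    set Φ : ℕ → ℝ → ℝ := fun i y =>
      ∑ d ∈ Ioc 0 ⌊y⌋₊, generalizedVonMangoldt b d / d * Real.log (y / d) ^ i with hΦ
    -- the recursion, termwise
    have hsplit : ∑ d ∈ Ioc 0 N, generalizedVonMangoldt (b + 1) d / d * Real.log (x / d) ^ m =
        (L * Φ m x - Φ (m + 1) x) +
          ∑ e ∈ Ioc 0 N, Λ e / e * Φ m (x / e) := by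
      have hterm : ∀ d ∈ Ioc 0 N, generalizedVonMangoldt (b + 1) d / d * Real.log (x / d) ^ m =
          (L * (generalizedVonMangoldt b d / d * Real.log (x / d) ^ m) -
            generalizedVonMangoldt b d / d * Real.log (x / d) ^ (m + 1)) +
          ∑ y ∈ d.divisorsAntidiagonal, Λ y.1 / y.1 * (generalizedVonMangoldt b y.2 / y.2 *
            Real.log (x / d) ^ m) := by
        intro d hd
        have hd0 : (0 : ℝ) < d := by exact_mod_cast (Finset.mem_Ioc.mp hd).1
        rw [generalizedVonMangoldt_succ, ArithmeticFunction.add_apply, ArithmeticFunction.pmul_apply,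
          ArithmeticFunction.log_apply, ArithmeticFunction.mul_apply, add_div, add_mul, Finset.sum_div,
          Finset.sum_mul]
        congr 1
        · have hlogd : Real.log d = L - Real.log (x / d) := by
            rw [Real.log_div hx0.ne' hd0.ne']; ring
          rw [hlogd, pow_succ]
          field_simp
        · refine Finset.sum_congr rfl fun y hy => ?_
          obtain ⟨hy', -⟩ := Nat.mem_divisorsAntidiagonal.mp hy
          have hy1 : (0 : ℝ) < y.1 := by
            exact_mod_cast Nat.pos_of_mem_divisors (Nat.fst_mem_divisors_of_mem_antidiagonal hy)
          have hy2 : (0 : ℝ) < y.2 := by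
            exact_mod_cast Nat.pos_of_mem_divisors (Nat.snd_mem_divisors_of_mem_antidiagonal hy)
          have hdd : (d : ℝ) = y.1 * y.2 := by rw [← hy']; push_cast; ring
          rw [hdd]
          field_simp
      rw [Finset.sum_congr rfl hterm, Finset.sum_add_distrib, Finset.sum_sub_distrib, ← Finset.mul_sum]
      congr 1
      have hre : ∀ n ∈ Ioc 0 N, ∑ y ∈ n.divisorsAntidiagonal, Λ y.1 / y.1 *
          (generalizedVonMangoldt b y.2 / y.2 * Real.log (x / n) ^ m) =
          ∑ y ∈ n.divisorsAntidiagonal, Λ y.1 / y.1 *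
            (generalizedVonMangoldt b y.2 / y.2 * Real.log (x / ((y.1 * y.2 : ℕ) : ℝ)) ^ m) :=
        fun n _ => Finset.sum_congr rfl fun y hy => by rw [(Nat.mem_divisorsAntidiagonal.mp hy).1]
      rw [Finset.sum_congr rfl hre, sum_Ioc_antidiagonal_eq_sum_sum (fun e f => Λ e / e *
        (generalizedVonMangoldt b f / f * Real.log (x / ((e * f : ℕ) : ℝ)) ^ m)) N]
      refine Finset.sum_congr rfl fun e he => ?_
      have he0 : (0 : ℝ) < e := by exact_mod_cast (Finset.mem_Ioc.mp he).1
      rw [hΦ, Finset.mul_sum, hN, Nat.floor_div_natCast]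
      refine Finset.sum_congr rfl fun f _ => ?_
      rw [Nat.cast_mul, ← div_div]
    -- the main pieces
    have h1 := hC₁ x hx
    have h2 := hC₂ x hx
    have hmert := SelbergSymmetry.abs_sum_vonMangoldt_div_sub_log_le hx
    -- weighted Mertens with exponent `b + m ≥ 1`
    obtain ⟨i, hi⟩ : ∃ i, b + m = i + 1 := ⟨b + m - 1, by omega⟩
    have hW := abs_sum_vonMangoldt_div_mul_pow_log_sub_le hx i
    have hi' : (i : ℝ) + 2 = (b : ℝ) + m + 1 := by
      have := congrArg (Nat.cast (R := ℝ)) hi; push_cast at this; linarith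
    rw [← hi, show i + 2 = b + m + 1 by omega, hi'] at hW
    -- the convolution term against the hypothesis at `x/e`
    have hconv : |∑ e ∈ Ioc 0 N, Λ e / e * Φ m (x / e) -
        B * ∑ e ∈ Ioc 0 N, Λ e / e * Real.log (x / e) ^ (b + m)| ≤ C₁' * (1 + L) ^ (b + m - 1) * (L + 6) := by
      rw [Finset.mul_sum, ← Finset.sum_sub_distrib]
      refine (Finset.abs_sum_le_sum_abs _ _).trans ?_
      have hpt : ∀ e ∈ Ioc 0 N, |Λ e / e * Φ m (x / e) - B * (Λ e / e * Real.log (x / e) ^ (b + m))| ≤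
          Λ e / e * (C₁' * (1 + L) ^ (b + m - 1)) := by
        intro e he
        obtain ⟨he1, heN⟩ := Finset.mem_Ioc.mp he
        have he0 : (0 : ℝ) < e := by exact_mod_cast he1
        have hex : (e : ℝ) ≤ x := (Nat.cast_le.mpr heN).trans (Nat.floor_le hx0.le)
        have hxe : 1 ≤ x / e := (one_le_div he0).mpr hex
        have hΛ : 0 ≤ Λ e / e := div_nonneg ArithmeticFunction.vonMangoldt_nonneg he0.le
        have hlog : Real.log (x / e) ≤ L := by
          rw [Real.log_div hx0.ne' he0.ne']; linarith [Real.log_nonneg (show (1:ℝ) ≤ e by exact_mod_cast he1)]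
        have hlog0 : 0 ≤ Real.log (x / e) := Real.log_nonneg hxe
        have h := hC₁ (x / e) hxe
        rw [show Λ e / e * Φ m (x / e) - B * (Λ e / e * Real.log (x / e) ^ (b + m)) =
          Λ e / e * (Φ m (x / e) - B * Real.log (x / e) ^ (b + m)) by ring, abs_mul, abs_of_nonneg hΛ]
        refine mul_le_mul_of_nonneg_left (h.trans ?_) hΛ
        exact mul_le_mul (le_max_left _ _) (pow_le_pow_left₀ (by linarith) (by linarith) _)
          (pow_nonneg (by linarith) _) (le_max_right _ _)
      refine (Finset.sum_le_sum hpt).trans ?_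
      rw [← Finset.sum_mul]
      have hsumΛ : ∑ e ∈ Ioc 0 N, Λ e / e ≤ L + 6 := by linarith [(abs_le.mp hmert).2]
      calc (∑ e ∈ Ioc 0 N, Λ e / e) * (C₁' * (1 + L) ^ (b + m - 1))
          ≤ (L + 6) * (C₁' * (1 + L) ^ (b + m - 1)) :=
            mul_le_mul_of_nonneg_right hsumΛ (by positivity)
        _ = C₁' * (1 + L) ^ (b + m - 1) * (L + 6) := by ring
    -- assemble
    rw [hsplit, betaCoeff_succ, show b + 1 + m - 1 = b + m by omega]
    have hid : (L * Φ m x - Φ (m + 1) x) + ∑ e ∈ Ioc 0 N, Λ e / e * Φ m (x / e) -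
        (B - B' + B / ((b + m : ℕ) + 1)) * L ^ (b + 1 + m) =
        L * (Φ m x - B * L ^ (b + m)) - (Φ (m + 1) x - B' * L ^ (b + (m + 1))) +
          (∑ e ∈ Ioc 0 N, Λ e / e * Φ m (x / e) - B * ∑ e ∈ Ioc 0 N, Λ e / e * Real.log (x / e) ^ (b + m)) +
          B * (∑ e ∈ Ioc 0 N, Λ e / e * Real.log (x / e) ^ (b + m) - L ^ (b + m + 1) / ((b + m : ℕ) + 1)) := by
      have e1 : L ^ (b + 1 + m) = L * L ^ (b + m) := by rw [show b + 1 + m = (b + m) + 1 by ring, pow_succ]; ring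
      have e2 : L ^ (b + (m + 1)) = L * L ^ (b + m) := by rw [show b + (m + 1) = (b + m) + 1 by ring, pow_succ]; ring
      have e3 : L ^ (b + m + 1) = L * L ^ (b + m) := by rw [pow_succ]; ring
      rw [e1, e2, e3]
      field_simp
      ring
    rw [hid]
    have hA : |L * (Φ m x - B * L ^ (b + m))| ≤ L * (C₁' * (1 + L) ^ (b + m - 1)) := by
      rw [abs_mul, abs_of_nonneg hL0]
      exact mul_le_mul_of_nonneg_left (h1.trans (mul_le_mul_of_nonneg_right (le_max_left _ _)
        (pow_nonneg (by linarith) _))) hL0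
    have hBb : |Φ (m + 1) x - B' * L ^ (b + (m + 1))| ≤ C₂' * (1 + L) ^ (b + m) := by
      refine h2.trans ?_
      rw [show b + (m + 1) - 1 = b + m by omega]
      exact mul_le_mul_of_nonneg_right (le_max_left _ _) (pow_nonneg (by linarith) _)
    have hCc := hconv
    have hD : |B * (∑ e ∈ Ioc 0 N, Λ e / e * Real.log (x / e) ^ (b + m) - L ^ (b + m + 1) / ((b + m : ℕ) + 1))| ≤
        B * (6 * L ^ (b + m)) := by
      rw [abs_mul, abs_of_nonneg hB0]
      refine mul_le_mul_of_nonneg_left ?_ hB0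
      push_cast at hW ⊢
      exact hW
    -- powers of `1 + L`
    have hpow1 : L * (1 + L) ^ (b + m - 1) ≤ (1 + L) ^ (b + m) := by
      calc L * (1 + L) ^ (b + m - 1) ≤ (1 + L) * (1 + L) ^ (b + m - 1) :=
            mul_le_mul_of_nonneg_right (by linarith) (pow_nonneg (by linarith) _)
        _ = (1 + L) ^ (b + m) := by rw [← pow_succ', show b + m - 1 + 1 = b + m by omega]
    have hpow2 : (1 + L) ^ (b + m - 1) * (L + 6) ≤ 6 * (1 + L) ^ (b + m) := by
      calc (1 + L) ^ (b + m - 1) * (L + 6) ≤ (1 + L) ^ (b + m - 1) * (6 * (1 + L)) :=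
            mul_le_mul_of_nonneg_left (by linarith) (pow_nonneg (by linarith) _)
        _ = 6 * ((1 + L) ^ (b + m - 1) * (1 + L)) := by ring
        _ = 6 * (1 + L) ^ (b + m) := by rw [← pow_succ, show b + m - 1 + 1 = b + m by omega]
    have hpow3 : L ^ (b + m) ≤ (1 + L) ^ (b + m) := pow_le_pow_left₀ hL0 (by linarith) _
    have hC₁'0 : 0 ≤ C₁' := le_max_right _ _
    calc |L * (Φ m x - B * L ^ (b + m)) - (Φ (m + 1) x - B' * L ^ (b + (m + 1))) +
          (∑ e ∈ Ioc 0 N, Λ e / e * Φ m (x / e) - B * ∑ e ∈ Ioc 0 N, Λ e / e * Real.log (x / e) ^ (b + m)) +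
          B * (∑ e ∈ Ioc 0 N, Λ e / e * Real.log (x / e) ^ (b + m) - L ^ (b + m + 1) / ((b + m : ℕ) + 1))|
        ≤ |L * (Φ m x - B * L ^ (b + m))| + |Φ (m + 1) x - B' * L ^ (b + (m + 1))| +
          |∑ e ∈ Ioc 0 N, Λ e / e * Φ m (x / e) - B * ∑ e ∈ Ioc 0 N, Λ e / e * Real.log (x / e) ^ (b + m)| +
          |B * (∑ e ∈ Ioc 0 N, Λ e / e * Real.log (x / e) ^ (b + m) - L ^ (b + m + 1) / ((b + m : ℕ) + 1))| := by
          refine (abs_add_le _ _).trans (add_le_add ((abs_add_le _ _).trans (add_le_add (abs_sub _ _) le_rfl)) le_rfl)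
      _ ≤ L * (C₁' * (1 + L) ^ (b + m - 1)) + C₂' * (1 + L) ^ (b + m) +
          C₁' * (1 + L) ^ (b + m - 1) * (L + 6) + B * (6 * L ^ (b + m)) :=
          add_le_add (add_le_add (add_le_add hA hBb) hCc) hD
      _ ≤ C₁' * (1 + L) ^ (b + m) + C₂' * (1 + L) ^ (b + m) + C₁' * (6 * (1 + L) ^ (b + m)) +
          B * (6 * (1 + L) ^ (b + m)) := by
          have t1 : L * (C₁' * (1 + L) ^ (b + m - 1)) ≤ C₁' * (1 + L) ^ (b + m) := by
            calc L * (C₁' * (1 + L) ^ (b + m - 1)) = C₁' * (L * (1 + L) ^ (b + m - 1)) := by ring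
              _ ≤ C₁' * (1 + L) ^ (b + m) := mul_le_mul_of_nonneg_left hpow1 hC₁'0
          have t3 : C₁' * (1 + L) ^ (b + m - 1) * (L + 6) ≤ C₁' * (6 * (1 + L) ^ (b + m)) := by
            calc C₁' * (1 + L) ^ (b + m - 1) * (L + 6) = C₁' * ((1 + L) ^ (b + m - 1) * (L + 6)) := by ring
              _ ≤ C₁' * (6 * (1 + L) ^ (b + m)) := mul_le_mul_of_nonneg_left hpow2 hC₁'0
          have t4 : B * (6 * L ^ (b + m)) ≤ B * (6 * (1 + L) ^ (b + m)) :=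
            mul_le_mul_of_nonneg_left (by linarith) hB0
          linarith
      _ = (C₁' + C₂' + 6 * B + 6 * C₁') * (1 + L) ^ (b + m) := by ring

/-! ### [FriedlanderIwaniecPisa1978] Lemma 3 for vectors (`K = ℚ`): `∑_{n ≤ x} Λ_(k)(n) ∼ γ_(k) x (log x)^{|k|−1}` -/

/-- **Chebyshev-type bound for `Λ_b`**: `∑_{n ≤ x} Λ_b(n) ≤ C x (1 + log x)^{b−1}` for `x ≥ 1`, `b ≥ 1`
(`b = 1`: Mathlib's `Chebyshev.psi_le_const_mul_self`; `b ≥ 2`: the tree's scalar Lemma 3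
`FI1978_lemma3_rat_explicit`). [folklore] -/
theorem sum_generalizedVonMangoldt_le (b : ℕ) (hb : 1 ≤ b) :
    ∃ C : ℝ, 0 ≤ C ∧ ∀ x : ℝ, 1 ≤ x →
      ∑ n ∈ Ioc 0 ⌊x⌋₊, generalizedVonMangoldt b n ≤ C * x * (1 + Real.log x) ^ (b - 1) := by
  rcases Nat.lt_or_ge b 2 with hb1 | hb2
  · obtain rfl : b = 1 := by omega
    refine ⟨Real.log 4 + 4, by have := Real.log_nonneg (show (1:ℝ) ≤ 4 by norm_num); positivity,
      fun x hx => ?_⟩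
    have h := Chebyshev.psi_le_const_mul_self (show (0 : ℝ) ≤ x by linarith)
    rw [Chebyshev.psi] at h
    simp only [generalizedVonMangoldt_one, Nat.sub_self, pow_zero, mul_one]
    exact h
  · obtain ⟨c, hc1, hc⟩ := FI1978_lemma3_rat_explicit
    have hc0 : 0 < c := by linarith
    have hlogc : 0 ≤ Real.log c := Real.log_nonneg hc1
    refine ⟨b + c ^ b * (1 + Real.log c) ^ (b - 2), by positivity, fun x hx => ?_⟩
    have hx0 : 0 < x := by linarith
    have hL0 : 0 ≤ Real.log x := Real.log_nonneg hx
    have h := hc b hb2 x hx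
    have h1 := (abs_le.mp h).2
    have hlogcx : Real.log (c * x) ≤ (1 + Real.log c) * (1 + Real.log x) := by
      rw [Real.log_mul hc0.ne' hx0.ne']; nlinarith
    have hlogcx0 : 0 ≤ Real.log (c * x) := Real.log_nonneg (by nlinarith)
    calc ∑ n ∈ Ioc 0 ⌊x⌋₊, generalizedVonMangoldt b n
        ≤ b * x * Real.log x ^ (b - 1) + c ^ b * x * Real.log (c * x) ^ (b - 2) := by linarith
      _ ≤ b * x * (1 + Real.log x) ^ (b - 1) +
          c ^ b * x * ((1 + Real.log c) * (1 + Real.log x)) ^ (b - 2) := by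
          gcongr
          · linarith
      _ = b * x * (1 + Real.log x) ^ (b - 1) +
          c ^ b * (1 + Real.log c) ^ (b - 2) * x * (1 + Real.log x) ^ (b - 2) := by rw [mul_pow]; ring
      _ ≤ b * x * (1 + Real.log x) ^ (b - 1) +
          c ^ b * (1 + Real.log c) ^ (b - 2) * x * (1 + Real.log x) ^ (b - 1) := by
          gcongr
          · linarith
          · omega
      _ = (b + c ^ b * (1 + Real.log c) ^ (b - 2)) * x * (1 + Real.log x) ^ (b - 1) := by ring

/-- **The convolution step of Lemma 3 for vectors**: if `G ≥ 0` has `∑_{n ≤ y} G(n) = γ y (log y)^{s−1} +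
o(y (log y)^{s−1})` (`s ≥ 2`), then for `b ≥ 1`,
`∑_{n ≤ x} (Λ_b * G)(n) = γ (b!(s−1)!/(b+s−1)!) x (log x)^{b+s−1} + o(x (log x)^{b+s−1})`:
Dirichlet's rearrangement `∑_{d ≤ x} Λ_b(d) S_G(x/d)`, the weighted Mertens estimate for `Λ_b`
(`weightedMertens_generalizedVonMangoldt`) in the main term, and the hypothesis at `x/d ≥ x₀` (resp. a
crude bound on `[1, x₀]` with `sum_generalizedVonMangoldt_le`) in the error term.
[cite: FriedlanderIwaniecPisa1978, Lemma 3 (proof, pp. 727–728)] -/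
theorem lemma3V_step {G : ArithmeticFunction ℝ} (hG0 : ∀ n, 0 ≤ G n) {γ : ℝ} (hγ : 0 ≤ γ) {s : ℕ}
    (hs : 2 ≤ s)
    (hG : ∀ ε : ℝ, 0 < ε → ∃ x₀ : ℝ, 1 ≤ x₀ ∧ ∀ y : ℝ, x₀ ≤ y →
      |(∑ n ∈ Ioc 0 ⌊y⌋₊, G n) - γ * y * Real.log y ^ (s - 1)| ≤ ε * y * Real.log y ^ (s - 1))
    {b : ℕ} (hb : 1 ≤ b) {ε : ℝ} (hε : 0 < ε) :
    ∃ x₀ : ℝ, 1 ≤ x₀ ∧ ∀ x : ℝ, x₀ ≤ x →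
      |(∑ n ∈ Ioc 0 ⌊x⌋₊, (generalizedVonMangoldt b * G) n) -
          (γ * ((b.factorial * (s - 1).factorial : ℝ) / ((b + (s - 1)).factorial : ℝ))) * x *
            Real.log x ^ (b + s - 1)| ≤ ε * x * Real.log x ^ (b + s - 1) := by
  -- constants
  obtain ⟨C, hC⟩ := weightedMertens_generalizedVonMangoldt b hb (s - 1)
  obtain ⟨C₀, hC₀⟩ := weightedMertens_generalizedVonMangoldt b hb 0
  obtain ⟨Cψ, hCψ0, hCψ⟩ := sum_generalizedVonMangoldt_le b hb
  set C' := max C 0 with hC'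
  set C₀' := max C₀ 0 + 1 with hC₀'
  have hC'0 : 0 ≤ C' := le_max_right _ _
  have hC₀'0 : 0 < C₀' := by have := le_max_right C₀ 0; linarith
  set B : ℝ := (b.factorial * (s - 1).factorial : ℝ) / ((b + (s - 1)).factorial : ℝ) with hB
  have hB0 : 0 ≤ B := by positivity
  -- the hypothesis with `ε'`
  set ε' : ℝ := ε / (4 * 2 ^ b * (1 + C₀')) with hε'
  have hε'0 : 0 < ε' := by positivity
  obtain ⟨x₀, hx₀1, hx₀⟩ := hG ε' hε'0
  -- the crude bound `M` on `[1, x₀]`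
  set SG : ℝ → ℝ := fun y => ∑ n ∈ Ioc 0 ⌊y⌋₊, G n with hSG
  have hSGmono : Monotone SG := fun y y' h =>
    Finset.sum_le_sum_of_subset_of_nonneg (Finset.Ioc_subset_Ioc_right (Nat.floor_mono h)) fun n _ _ => hG0 n
  have hSG0 : ∀ y, 0 ≤ SG y := fun y => Finset.sum_nonneg fun n _ => hG0 n
  set M : ℝ := SG x₀ + γ * x₀ * Real.log x₀ ^ (s - 1) with hM
  have hM0 : 0 ≤ M := by
    have := hSG0 x₀; have := Real.log_nonneg hx₀1; positivity
  have hcrude : ∀ y : ℝ, 1 ≤ y → y ≤ x₀ → |SG y - γ * y * Real.log y ^ (s - 1)| ≤ M := by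
    intro y hy1 hyx
    have hly : 0 ≤ Real.log y := Real.log_nonneg hy1
    have hmain0 : 0 ≤ γ * y * Real.log y ^ (s - 1) := by positivity
    have hmain : γ * y * Real.log y ^ (s - 1) ≤ γ * x₀ * Real.log x₀ ^ (s - 1) := by
      gcongr
    rw [abs_le]
    constructor <;> nlinarith [hSG0 y, hSGmono hyx]
  -- thresholds in `x`
  set K₁ : ℝ := γ * C' * 2 ^ (b + s - 2) with hK₁
  set K₃ : ℝ := M * Cψ * 2 ^ (b - 1) with hK₃
  have hev : ∀ᶠ x : ℝ in atTop, x₀ ≤ x ∧ Real.exp 1 ≤ x ∧ 4 * K₁ / ε ≤ Real.log x ∧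
      4 * K₃ / ε ≤ Real.log x ^ s := by
    refine (eventually_ge_atTop x₀).and ((eventually_ge_atTop _).and
      ((Real.tendsto_log_atTop.eventually_ge_atTop _).and ?_))
    exact (tendsto_pow_atTop (by omega : s ≠ 0)).comp Real.tendsto_log_atTop |>.eventually_ge_atTop _
  obtain ⟨X, hX⟩ := Filter.eventually_atTop.mp hev
  refine ⟨max X 1, le_max_right _ _, fun x hx => ?_⟩
  obtain ⟨hxx₀, hxe, hxK₁, hxK₃⟩ := hX x ((le_max_left _ _).trans hx)
  have hx1 : 1 ≤ x := (le_max_right _ _).trans hx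
  have hx0 : 0 < x := by linarith
  set L := Real.log x with hL
  have hL1 : 1 ≤ L := by rw [hL, ← Real.log_exp 1]; exact Real.log_le_log (Real.exp_pos 1) hxe
  have hL0 : 0 ≤ L := by linarith
  set N := ⌊x⌋₊ with hN
  -- Dirichlet's rearrangement
  have hconv : ∑ n ∈ Ioc 0 N, (generalizedVonMangoldt b * G) n =
      ∑ d ∈ Ioc 0 N, generalizedVonMangoldt b d * SG (x / d) := by
    rw [ArithmeticFunction.sum_Ioc_mul_eq_sum_sum]
    refine Finset.sum_congr rfl fun d _ => ?_
    rw [hSG]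
    simp only
    rw [hN, Nat.floor_div_natCast]
  -- decomposition into main term and remainder
  set R : ℝ → ℝ := fun y => SG y - γ * y * Real.log y ^ (s - 1) with hR
  have hdec : ∑ d ∈ Ioc 0 N, generalizedVonMangoldt b d * SG (x / d) =
      γ * x * ∑ d ∈ Ioc 0 N, generalizedVonMangoldt b d / d * Real.log (x / d) ^ (s - 1) +
        ∑ d ∈ Ioc 0 N, generalizedVonMangoldt b d * R (x / d) := by
    rw [Finset.mul_sum, ← Finset.sum_add_distrib]
    refine Finset.sum_congr rfl fun d hd => ?_
    have hd0 : (0 : ℝ) < d := by exact_mod_cast (Finset.mem_Ioc.mp hd).1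
    rw [hR]
    simp only
    field_simp
    ring
  -- the remainder
  have hrem : |∑ d ∈ Ioc 0 N, generalizedVonMangoldt b d * R (x / d)| ≤
      ε' * x * L ^ (s - 1) * (C₀' * (1 + L) ^ b) + M * (Cψ * x * (1 + L) ^ (b - 1)) := by
    refine (Finset.abs_sum_le_sum_abs _ _).trans ?_
    have hpt : ∀ d ∈ Ioc 0 N, |generalizedVonMangoldt b d * R (x / d)| ≤
        ε' * x * L ^ (s - 1) * (generalizedVonMangoldt b d / d) + M * generalizedVonMangoldt b d := by
      intro d hd
      obtain ⟨hd1, hdN⟩ := Finset.mem_Ioc.mp hd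
      have hd0 : (0 : ℝ) < d := by exact_mod_cast hd1
      have hdx : (d : ℝ) ≤ x := (Nat.cast_le.mpr hdN).trans (Nat.floor_le hx0.le)
      have hxd1 : 1 ≤ x / d := (one_le_div hd0).mpr hdx
      have hΛ : 0 ≤ generalizedVonMangoldt b d := generalizedVonMangoldt_nonneg b d
      have hlog : Real.log (x / d) ≤ L := by
        rw [Real.log_div hx0.ne' hd0.ne']; linarith [Real.log_nonneg (show (1:ℝ) ≤ d by exact_mod_cast hd1)]
      have hlog0 : 0 ≤ Real.log (x / d) := Real.log_nonneg hxd1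
      rw [abs_mul, abs_of_nonneg hΛ]
      rcases le_or_gt x₀ (x / d) with hbig | hsmall
      · have h := hx₀ (x / d) hbig
        calc generalizedVonMangoldt b d * |R (x / d)| ≤ generalizedVonMangoldt b d *
            (ε' * (x / d) * Real.log (x / d) ^ (s - 1)) := mul_le_mul_of_nonneg_left h hΛ
          _ ≤ generalizedVonMangoldt b d * (ε' * (x / d) * L ^ (s - 1)) := by gcongr
          _ = ε' * x * L ^ (s - 1) * (generalizedVonMangoldt b d / d) + M * 0 := by field_simp; ring
          _ ≤ ε' * x * L ^ (s - 1) * (generalizedVonMangoldt b d / d) + M * generalizedVonMangoldt b d := by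
              gcongr
      · have h := hcrude (x / d) hxd1 hsmall.le
        calc generalizedVonMangoldt b d * |R (x / d)| ≤ generalizedVonMangoldt b d * M :=
              mul_le_mul_of_nonneg_left h hΛ
          _ = ε' * x * L ^ (s - 1) * 0 + M * generalizedVonMangoldt b d := by ring
          _ ≤ ε' * x * L ^ (s - 1) * (generalizedVonMangoldt b d / d) + M * generalizedVonMangoldt b d := by
              gcongr
              exact div_nonneg hΛ hd0.le
    refine (Finset.sum_le_sum hpt).trans ?_
    rw [Finset.sum_add_distrib, ← Finset.mul_sum, ← Finset.mul_sum]
    refine add_le_add (mul_le_mul_of_nonneg_left ?_ (by positivity))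
      (mul_le_mul_of_nonneg_left (hCψ x hx1) hM0)
    -- `∑ Λ_b(d)/d ≤ C₀' (1 + L)^b` from the weighted Mertens estimate with `m = 0`
    have h0 := hC₀ x hx1
    simp only [pow_zero, mul_one, Nat.factorial_zero, Nat.cast_one, add_zero] at h0
    have hcoef : (b.factorial : ℝ) / (b.factorial : ℝ) = 1 := div_self (by positivity)
    rw [hcoef, one_mul] at h0
    have h0' := (abs_le.mp h0).2
    have hmax : C₀ * (1 + L) ^ (b - 1) ≤ (max C₀ 0) * (1 + L) ^ b := by
      calc C₀ * (1 + L) ^ (b - 1) ≤ max C₀ 0 * (1 + L) ^ (b - 1) :=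
            mul_le_mul_of_nonneg_right (le_max_left _ _) (pow_nonneg (by linarith) _)
        _ ≤ max C₀ 0 * (1 + L) ^ b :=
            mul_le_mul_of_nonneg_left (pow_le_pow_right₀ (by linarith) (by omega)) (le_max_right _ _)
    have hLb : L ^ b ≤ (1 + L) ^ b := pow_le_pow_left₀ hL0 (by linarith) _
    calc ∑ d ∈ Ioc 0 N, generalizedVonMangoldt b d / d ≤ L ^ b + C₀ * (1 + L) ^ (b - 1) := by linarith
      _ ≤ (1 + L) ^ b + max C₀ 0 * (1 + L) ^ b := add_le_add hLb hmax
      _ = C₀' * (1 + L) ^ b := by rw [hC₀']; ring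
  -- the main term
  have hmainW := hC x hx1
  rw [show b + (s - 1) - 1 = b + s - 2 by omega, show b + (s - 1) = b + s - 1 by omega] at hmainW
  -- assemble
  rw [hconv, hdec]
  have hid : γ * x * ∑ d ∈ Ioc 0 N, generalizedVonMangoldt b d / d * Real.log (x / d) ^ (s - 1) +
      ∑ d ∈ Ioc 0 N, generalizedVonMangoldt b d * R (x / d) - γ * B * x * L ^ (b + s - 1) =
      γ * x * (∑ d ∈ Ioc 0 N, generalizedVonMangoldt b d / d * Real.log (x / d) ^ (s - 1) - B * L ^ (b + s - 1)) +
        ∑ d ∈ Ioc 0 N, generalizedVonMangoldt b d * R (x / d) := by ring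
  rw [hid]
  refine (abs_add_le _ _).trans ?_
  have hA : |γ * x * (∑ d ∈ Ioc 0 N, generalizedVonMangoldt b d / d * Real.log (x / d) ^ (s - 1) -
      B * L ^ (b + s - 1))| ≤ γ * x * (C' * (1 + L) ^ (b + s - 2)) := by
    rw [abs_mul, abs_of_nonneg (by positivity : 0 ≤ γ * x)]
    exact mul_le_mul_of_nonneg_left (hmainW.trans (mul_le_mul_of_nonneg_right (le_max_left _ _)
      (pow_nonneg (by linarith) _))) (by positivity)
  refine (add_le_add hA hrem).trans ?_
  -- numerics: `(1 + L)^k ≤ 2^k L^k` for `L ≥ 1`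
  have h2L : 1 + L ≤ 2 * L := by linarith
  have hp1 : (1 + L) ^ (b + s - 2) ≤ 2 ^ (b + s - 2) * L ^ (b + s - 2) := by
    rw [← mul_pow]; exact pow_le_pow_left₀ (by linarith) h2L _
  have hp2 : (1 + L) ^ b ≤ 2 ^ b * L ^ b := by
    rw [← mul_pow]; exact pow_le_pow_left₀ (by linarith) h2L _
  have hp3 : (1 + L) ^ (b - 1) ≤ 2 ^ (b - 1) * L ^ (b - 1) := by
    rw [← mul_pow]; exact pow_le_pow_left₀ (by linarith) h2L _
  -- term A ≤ (ε/4) x L^{b+s-1}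
  have tA : γ * x * (C' * (1 + L) ^ (b + s - 2)) ≤ ε / 4 * x * L ^ (b + s - 1) := by
    have hK₁' : K₁ ≤ ε / 4 * L := by
      rw [div_le_iff₀ hε] at hxK₁; linarith
    calc γ * x * (C' * (1 + L) ^ (b + s - 2)) ≤ γ * x * (C' * (2 ^ (b + s - 2) * L ^ (b + s - 2))) := by gcongr
      _ = K₁ * x * L ^ (b + s - 2) := by rw [hK₁]; ring
      _ ≤ (ε / 4 * L) * x * L ^ (b + s - 2) := by gcongr
      _ = ε / 4 * x * (L ^ (b + s - 2) * L) := by ring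
      _ = ε / 4 * x * L ^ (b + s - 1) := by rw [← pow_succ, show b + s - 2 + 1 = b + s - 1 by omega]
  -- term 2 ≤ (ε/4) x L^{b+s-1}
  have tB : ε' * x * L ^ (s - 1) * (C₀' * (1 + L) ^ b) ≤ ε / 4 * x * L ^ (b + s - 1) := by
    have h2b : (0 : ℝ) < 2 ^ b := pow_pos two_pos b
    have hε'' : ε' * (2 ^ b * C₀') ≤ ε / 4 := by
      rw [hε', div_mul_eq_mul_div, div_le_div_iff₀ (by positivity) (by norm_num)]
      have h4 : 0 ≤ 4 * (ε * 2 ^ b) := by positivity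
      have h5 : ε * (2 ^ b * C₀') * 4 = 4 * (ε * 2 ^ b) * C₀' := by ring
      have h6 : ε * (4 * 2 ^ b * (1 + C₀')) = 4 * (ε * 2 ^ b) * C₀' + 4 * (ε * 2 ^ b) := by ring
      rw [h5, h6]
      linarith only [h4]
    calc ε' * x * L ^ (s - 1) * (C₀' * (1 + L) ^ b) ≤ ε' * x * L ^ (s - 1) * (C₀' * (2 ^ b * L ^ b)) :=
          mul_le_mul_of_nonneg_left (mul_le_mul_of_nonneg_left hp2 hC₀'0.le) (by positivity)
      _ = (ε' * (2 ^ b * C₀')) * x * L ^ (b + s - 1) := by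
          rw [show b + s - 1 = (s - 1) + b by omega, pow_add]; ring
      _ ≤ (ε / 4) * x * L ^ (b + s - 1) :=
          mul_le_mul_of_nonneg_right (mul_le_mul_of_nonneg_right hε'' hx0.le) (by positivity)
  -- term 3 ≤ (ε/4) x L^{b+s-1}
  have tC : M * (Cψ * x * (1 + L) ^ (b - 1)) ≤ ε / 4 * x * L ^ (b + s - 1) := by
    have hK₃' : K₃ ≤ ε / 4 * L ^ s := by
      rw [div_le_iff₀ hε] at hxK₃; linarith
    calc M * (Cψ * x * (1 + L) ^ (b - 1)) ≤ M * (Cψ * x * (2 ^ (b - 1) * L ^ (b - 1))) := by gcongr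
      _ = K₃ * x * L ^ (b - 1) := by rw [hK₃]; ring
      _ ≤ (ε / 4 * L ^ s) * x * L ^ (b - 1) := by gcongr
      _ = ε / 4 * x * (L ^ s * L ^ (b - 1)) := by ring
      _ = ε / 4 * x * L ^ (b + s - 1) := by rw [← pow_add, show s + (b - 1) = b + s - 1 by omega]
  have hx4 : 0 ≤ ε / 4 * x * L ^ (b + s - 1) := by positivity
  linarith

/-- `γ(k) := ∏ kᵢ! / (|k| − 1)!`, the constant of Lemma 3 for `K = ℚ`.
[cite: FriedlanderIwaniecPisa1978, (1.1) and Lemma 3] -/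
noncomputable def gammaV (ks : List ℕ) : ℝ :=
  ((ks.map Nat.factorial).prod : ℝ) / ((ks.sum - 1).factorial : ℝ)

/-- [folklore] -/
theorem gammaV_nonneg (ks : List ℕ) : 0 ≤ gammaV ks := by
  unfold gammaV; positivity

/-- **[FriedlanderIwaniecPisa1978] Lemma 3 for vectors `(a, rest)` with `a ≥ 2` (`K = ℚ`)**:
`∑_{n ≤ x} Λ_(k)(n) = γ(k) x (log x)^{|k|−1} + o(x (log x)^{|k|−1})`, by induction on the length:
the scalar case is the tree's `FI1978_lemma3_rat_explicit`, a component `0` is harmless (`Λ_0 = 1`),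
and a component `b ≥ 1` is added by `lemma3V_step`. [cite: FriedlanderIwaniecPisa1978, Lemma 3] -/
theorem lemma3V_cons (a : ℕ) (ha : 2 ≤ a) (rest : List ℕ) {ε : ℝ} (hε : 0 < ε) :
    ∃ x₀ : ℝ, 1 ≤ x₀ ∧ ∀ x : ℝ, x₀ ≤ x →
      |(∑ n ∈ Ioc 0 ⌊x⌋₊, lambdaVec (a :: rest) n) -
          gammaV (a :: rest) * x * Real.log x ^ ((a :: rest).sum - 1)| ≤
        ε * x * Real.log x ^ ((a :: rest).sum - 1) := by
  induction rest generalizing ε with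
  | nil =>
    obtain ⟨c, hc1, hc⟩ := FI1978_lemma3_rat_explicit
    have hc0 : 0 < c := by linarith
    have hsum : ([a] : List ℕ).sum = a := by simp
    have hγ : gammaV [a] = a := by
      unfold gammaV
      rw [hsum]
      simp only [List.map_cons, List.map_nil, List.prod_cons, List.prod_nil, mul_one]
      obtain ⟨a', rfl⟩ : ∃ a', a = a' + 1 := ⟨a - 1, by omega⟩
      rw [Nat.add_sub_cancel, Nat.factorial_succ, Nat.cast_mul, mul_div_assoc,
        div_self (by positivity), mul_one]
    have hΛ : ∀ n, lambdaVec [a] n = generalizedVonMangoldt a n := by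
      intro n; simp [lambdaVec]
    -- thresholds: `x ≥ c` (so `log (cx) ≤ 2 log x`) and `c^a 2^(a-2) ≤ ε log x`
    have hev : ∀ᶠ x : ℝ in atTop, c ≤ x ∧ c ^ a * 2 ^ (a - 2) / ε ≤ Real.log x :=
      (eventually_ge_atTop c).and (Real.tendsto_log_atTop.eventually_ge_atTop _)
    obtain ⟨X, hX⟩ := Filter.eventually_atTop.mp hev
    refine ⟨max X 1, le_max_right _ _, fun x hx => ?_⟩
    obtain ⟨hxc, hxL⟩ := hX x ((le_max_left _ _).trans hx)
    have hx1 : 1 ≤ x := (le_max_right _ _).trans hx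
    have hx0 : 0 < x := by linarith
    have hL0 : 0 ≤ Real.log x := Real.log_nonneg hx1
    simp only [hΛ, hγ, hsum]
    refine (hc a ha x hx1).trans ?_
    have hlogcx : Real.log (c * x) ≤ 2 * Real.log x := by
      rw [Real.log_mul hc0.ne' hx0.ne']; linarith [Real.log_le_log hc0 hxc]
    have hlogcx0 : 0 ≤ Real.log (c * x) := Real.log_nonneg (by nlinarith)
    have hεL : c ^ a * 2 ^ (a - 2) ≤ ε * Real.log x := by rw [div_le_iff₀ hε] at hxL; linarith
    calc c ^ a * x * Real.log (c * x) ^ (a - 2) ≤ c ^ a * x * (2 * Real.log x) ^ (a - 2) := by gcongr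
      _ = (c ^ a * 2 ^ (a - 2)) * x * Real.log x ^ (a - 2) := by rw [mul_pow]; ring
      _ ≤ (ε * Real.log x) * x * Real.log x ^ (a - 2) := by gcongr
      _ = ε * x * (Real.log x ^ (a - 2) * Real.log x) := by ring
      _ = ε * x * Real.log x ^ (a - 1) := by rw [← pow_succ, show a - 2 + 1 = a - 1 by omega]
  | cons b rest ih =>
    rcases Nat.eq_zero_or_pos b with rfl | hb
    · obtain ⟨x₀, hx₀1, hx₀⟩ := ih hε
      refine ⟨x₀, hx₀1, fun x hx => ?_⟩
      have h1 : ∀ n, lambdaVec (a :: 0 :: rest) n = lambdaVec (a :: rest) n := by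
        intro n
        simp only [lambdaVec, List.map_cons, List.prod_cons, generalizedVonMangoldt_zero, one_mul]
      have h2 : gammaV (a :: 0 :: rest) = gammaV (a :: rest) := by simp [gammaV]
      have h3 : (a :: 0 :: rest).sum = (a :: rest).sum := by simp
      simp only [h1, h2, h3]
      exact hx₀ x hx
    · have hs : 2 ≤ (a :: rest).sum := by simp; omega
      obtain ⟨x₀, hx₀1, hx₀⟩ := lemma3V_step (G := lambdaVec (a :: rest)) (lambdaVec_apply_nonneg _)
        (gammaV_nonneg (a :: rest)) hs (fun ε hε => ih hε) hb hε
      refine ⟨x₀, hx₀1, fun x hx => ?_⟩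
      have h1 : ∀ n, lambdaVec (a :: b :: rest) n = (generalizedVonMangoldt b * lambdaVec (a :: rest)) n := by
        intro n
        simp only [lambdaVec, List.map_cons, List.prod_cons]
        rw [mul_left_comm]
      have h3 : (a :: b :: rest).sum - 1 = b + (a :: rest).sum - 1 := by simp; omega
      have h2 : gammaV (a :: b :: rest) = gammaV (a :: rest) *
          ((b.factorial * ((a :: rest).sum - 1).factorial : ℝ) / ((b + ((a :: rest).sum - 1)).factorial : ℝ)) := by
        unfold gammaV
        rw [h3, show b + (a :: rest).sum - 1 = b + ((a :: rest).sum - 1) by omega]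
        simp only [List.map_cons, List.prod_cons, Nat.cast_mul]
        field_simp
      simp only [h1, h2, h3]
      exact hx₀ x hx

/-- **[FriedlanderIwaniecPisa1978] Lemma 3 for admissible vectors (`K = ℚ`)**: for `k = (k₁, …, k_r)` with
some `kᵢ ≥ 2`, `∑_{n ≤ x} Λ_(k)(n) = γ(k) x (log x)^{|k|−1} + o(x (log x)^{|k|−1})` (reduction to
`lemma3V_cons` by permuting an entry `≥ 2` to the front). [cite: FriedlanderIwaniecPisa1978, Lemma 3] -/
theorem lemma3V (ks : List ℕ) (hks : ∃ a ∈ ks, 2 ≤ a) {ε : ℝ} (hε : 0 < ε) :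
    ∃ x₀ : ℝ, 1 ≤ x₀ ∧ ∀ x : ℝ, x₀ ≤ x →
      |(∑ n ∈ Ioc 0 ⌊x⌋₊, lambdaVec ks n) - gammaV ks * x * Real.log x ^ (ks.sum - 1)| ≤
        ε * x * Real.log x ^ (ks.sum - 1) := by
  obtain ⟨a, ha, ha2⟩ := hks
  have hp : ks.Perm (a :: ks.erase a) := List.perm_cons_erase ha
  have h1 : lambdaVec ks = lambdaVec (a :: ks.erase a) := (hp.map _).prod_eq
  have h2 : ks.sum = (a :: ks.erase a).sum := hp.sum_eq
  have h3 : gammaV ks = gammaV (a :: ks.erase a) := by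
    unfold gammaV; rw [h2, (hp.map Nat.factorial).prod_eq]
  rw [h1, h2, h3]
  exact lemma3V_cons a ha2 (ks.erase a) hε

/-! ### Assembly: Theorem 1 for vectors -/

/-- [folklore] -/
theorem gammaV_pos (ks : List ℕ) : 0 < gammaV ks := by
  unfold gammaV
  have h : 0 < ((ks.map Nat.factorial).prod : ℝ) := by
    have : 0 < (ks.map Nat.factorial).prod :=
      List.prod_pos fun k hk => by
        obtain ⟨i, -, rfl⟩ := List.mem_map.mp hk
        exact Nat.factorial_pos i
    exact_mod_cast this
  positivity

/-- **Theorem 1 for a vector `(j+2) :: k'`** (the main theorem with its entry `≥ 2` in front):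
`∑_{n ≤ x} a_n Λ_(k)(n) ∼ γ(k) H A(x) (log x)^{|k|−1}`. The comparison argument of
[FriedlanderIwaniecPisa1978] p. 740: `coreV` for `𝒜` and for the integers at a common `u`, the
vector Lemma 3 (`lemma3V_cons`) for the integers, and the tree's `comparison_arith`.
[cite: FriedlanderIwaniecPisa1978, Theorem 1 and p. 740] -/
theorem vector_cons {A : SieveSequence} {H : ℝ} (hA : A.IsBombieriSequence)
    (hH : A.HasDensityConstant H) (ks' : List ℕ) (j : ℕ) :
    (fun x : ℝ => ∑ n ∈ Ioc 0 ⌊x⌋₊, lambdaVec ((j + 2) :: ks') n * A.a n) ~[atTop]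
      fun x : ℝ => gammaV ((j + 2) :: ks') * H * A.size x * Real.log x ^ (j + 1 + ks'.sum) := by
  set m : ℕ := j + ks'.sum with hm
  have ejm : j + 1 + ks'.sum = m + 1 := by rw [hm]; ring
  have hsum : ((j + 2) :: ks').sum - 1 = m + 1 := by rw [List.sum_cons, hm]; omega
  obtain ⟨H', hH'0, hH', -⟩ := FI1978_lemma7_holds A hA
  have hHH' : H = H' := tendsto_nhds_unique hH hH'
  have hH0 : 0 < H := hHH' ▸ hH'0
  rw [Asymptotics.IsEquivalent, Asymptotics.isLittleO_iff]
  intro c hc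
  simp only [ejm]
  set κ : ℝ := gammaV ((j + 2) :: ks') with hκ
  have hκ0 : 0 < κ := gammaV_pos _
  -- the two applications of `coreV` at a common `u`
  have hcoreA := coreV hA hH ks' j (ε := c * κ * H / 2) (by positivity)
  have hcore1 := coreV SieveSequence.integers_isBombieriSequence
    SieveSequence.hasDensityConstant_integers ks' j (ε := c * κ / 4) (by positivity)
  obtain ⟨u, huA, hu1⟩ := (hcoreA.and hcore1).exists
  simp only [ejm] at huA hu1
  set ε₃ : ℝ := c * κ / 12 with hε₃
  have hε₃0 : 0 < ε₃ := by positivity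
  -- Lemma 3 for the vector
  obtain ⟨x₃, -, hx₃⟩ := lemma3V_cons (j + 2) (by omega) ks' hε₃0
  simp only [hsum] at hx₃
  filter_upwards [huA, hu1, eventually_ge_atTop x₃, eventually_ge_atTop (3 : ℝ),
    eventually_ge_atTop (2 * κ / ε₃)] with x hxA hx1 hxx₃ hx3 hxfl
  have hx2 : 2 ≤ x := by linarith
  have hx0 : 0 < x := by linarith
  set L := Real.log x with hL
  set S := A.size x with hS
  set N : ℝ := (⌊x⌋₊ : ℝ) with hN
  set F := mainTermFV ks' (j + 2) x (x ^ (1 - 2 * u⁻¹ ^ 3)) (x ^ (u⁻¹ ^ 4)) with hF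
  have hL1 : 1 ≤ L :=
    LFunctions.MertensBound.one_lt_log_three.le.trans (Real.log_le_log (by norm_num) hx3)
  have hL0 : 0 < L := by linarith
  have hS0 : 0 ≤ S := SieveSequence.size_nonneg_of_size_eq hA.size_eq x
  have hNx : x / 2 ≤ N := half_le_floor hx2
  have hN0 : 0 < N := by linarith
  have hNle : N ≤ x := Nat.floor_le hx0.le
  have hxN1 : x - N ≤ 1 := by have := Nat.lt_floor_add_one x; rw [hN]; linarith
  have hx2N : x ≤ 2 * N := by linarith
  have hκN : κ ≤ ε₃ * N := by
    rw [div_le_iff₀ hε₃0] at hxfl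
    calc κ = (2 * κ) / 2 := by ring
      _ ≤ x * ε₃ / 2 := by gcongr
      _ = ε₃ * (x / 2) := by ring
      _ ≤ ε₃ * N := mul_le_mul_of_nonneg_left hNx hε₃0.le
  -- the integers
  have hsum1 : ∑ n ∈ Ioc 0 ⌊x⌋₊, lambdaVec ((j + 2) :: ks') n * SieveSequence.integers.a n =
      ∑ n ∈ Ioc 0 ⌊x⌋₊, lambdaVec ((j + 2) :: ks') n :=
    Finset.sum_congr rfl fun n _ => by rw [SieveSequence.integers_a, mul_one]
  rw [hsum1, SieveSequence.integers_size, one_mul] at hx1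
  have h3xx := hx₃ x hxx₃
  -- conclusion
  have hM0 : 0 ≤ κ * H * S * L ^ (m + 1) := by positivity
  rw [Pi.sub_apply, Real.norm_eq_abs, Real.norm_eq_abs, abs_of_nonneg hM0]
  exact comparison_arith hH0 hS0 hN0 (by positivity) hκ0.le hc.le hNle hxN1 hx2N hκN hxA hx1 h3xx

end BombieriSieve

/-- **Bombieri's asymptotic sieve for vectors `k = (k₁, …, k_r)`, DISCHARGED**
([FriedlanderIwaniecPisa1978] Theorem 1 (Bombieri) with `K = ℚ`, p. 722): under (A₁)–(A₅) and
`A.HasDensityConstant H`, for every `k` with some `kᵢ ≥ 2`,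
`∑_{n ≤ x} a_n Λ_(k)(n) ∼ (∏ kᵢ! / (|k|−1)!) H A(x) (log x)^{|k|−1}`. Proof: permute an entry `≥ 2`
to the front (`Λ_(k)`, `|k|` and `∏ kᵢ!` are symmetric; p. 735: "the order of the components is
clearly immaterial") and apply `BombieriSieve.vector_cons`, which re-runs the tree's formalisation of
[FriedlanderIwaniecPisa1978] §4 with `𝔏_(k') = μ * Λ_(k')` in place of `μ`
(`BombieriSieve.lemma11V`, `lemma12V`, `coreV`, `lemma3V`).
[cite: FriedlanderIwaniecPisa1978, Theorem 1 (p. 722) and pp. 735–740] -/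
theorem Bombieri1976_asymptotic_sieve_vector_holds : Bombieri1976_asymptotic_sieve_vector := by
  intro A H hA hH ks hks
  obtain ⟨a, ha, ha2⟩ := hks
  obtain ⟨j, rfl⟩ : ∃ j, a = j + 2 := ⟨a - 2, by omega⟩
  have hp : ks.Perm ((j + 2) :: ks.erase (j + 2)) := List.perm_cons_erase ha
  have h1 : (ks.map generalizedVonMangoldt).prod =
      BombieriSieve.lambdaVec ((j + 2) :: ks.erase (j + 2)) := (hp.map _).prod_eq
  have h2 : ks.sum = ((j + 2) :: ks.erase (j + 2)).sum := hp.sum_eq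
  have h3 : (ks.map Nat.factorial).prod = (((j + 2) :: ks.erase (j + 2)).map Nat.factorial).prod :=
    (hp.map _).prod_eq
  have h4 : ((j + 2) :: ks.erase (j + 2)).sum - 1 = j + 1 + (ks.erase (j + 2)).sum := by
    rw [List.sum_cons]; omega
  have hmain := BombieriSieve.vector_cons hA hH (ks.erase (j + 2)) j
  rw [h1, h2, h3, h4]
  refine hmain.congr_right (Filter.Eventually.of_forall fun x => ?_)
  simp only [BombieriSieve.gammaV, h4]

end Literature.NumberTheory.Sieve
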